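import Literature.MathematicalPhysics.QuantumFieldTheory.Balaban1983to89.B15Prop1EndpointNearFlatLetters
import Literature.MathematicalPhysics.QuantumFieldTheory.Balaban1983to89.B15Prop1DatumGaugeNormalisation
import Literature.MathematicalPhysics.QuantumFieldTheory.Balaban1983to89.B15Prop1CoerciveEdition

/-!
# `Balaban1983to89.B15Prop1CoerciveAtNormalisedDatum` — [Balaban1989LargeFieldI] = «[IV]», (1.74) p. 192, p. 193 (the extension `Ṽ_k`), (1.77) and the sentence after it,
# Prop. 1 p. 194; [Balaban1989LargeFieldII] = «[LF-II]», p. 357, (1.7)–(1.9) p. 358, (1.12)–(1.13) p. 359: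
# ★★★ THE (1.9) COERCIVITY LETTER OF PROPOSITION 1 AT EVERY REGULAR BASE FIELD FROM THE NEAR-FLAT PACKAGE (N) AT THE GAUGE-NORMALISED DATA ONLY

Honest framing: statement-level skeleton of published theorems with citation tags; proofs where landed; nothing here is a claim about the
Yang–Mills mass gap.  Cell `pub-ymgap`, HUMAN RULING D-0062 ∕ D-0149, seat `pub-ymgap-dag-n12-c` (g18; N12 = [B15], strategy s1, lane owner); count-neutral helper of
K1⁸; N12 NOT discharged; finite 𝕋⁴ at fixed ε; nothing continuum ∕ OS ∕ mass-gap ∕ Clay.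

WHY (the coercivity road (β′) of the N12∕s1 lane, decided with dag-n12-w6 g1, 2026-08-28).  The lane's assembled endpoint `B15Prop1EndpointNearFlatLetters` (J-C v1.2,
`…_ofNearFlatLetters_sub_loc_oneSided`) reads Proposition 1 [IV] at print's (1.74) object from the near-flat letter package (N), asked per instance and PER BASE FIELD `V_k`
in the (1.74) guard.  The package is inhabitable only where the extended datum `Ṽ_k = extend Λ^{(k)} (shellGauge V_k) V_k` of p. 193 is bond-wise near `1` around the
region where the minimiser family moves — and at a RAW regular `V_k` it is not: off `Λ^{(k)}` the datum is `V_k` itself (any gauge), on the bonds meeting `Λ^{(k)}` a pure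
gauge (dag-n12-w5's LOCATED-`hU`, dag-n12-w6's LOCATED-T).  Print's remedy is the sentence after (1.77), p. 194: *«The function is invariant with respect to the group of all
gauge transformations defined on Λ, hence it is natural to consider it on orbits of this group.»*  The one-sided (1.7) letter `h17` of the lane's chain is a statement about
the lattice curl of the slice coordinates and is NOT constant on gauge orbits (the coordinates rotate bond-wise by `Ad(u(b₋)⁻¹)`, dag-n12-w6's §6); but what the chain
CONSUMES of `h17` is only [LF-II]'s (1.9) — the coercivity `γ∕M⁵·‖X‖² ≤ ⟨X, D(∇ sliceFn)(0) X⟩` of the slice Hessian (`B15Prop1OneSidedIneq17OfFun.hessian_coercive_of_h17`, the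
(1.67) + (1.8) Schur step) — and (1.9) IS constant on gauge orbits (`B15Prop1DatumGaugeNormalisation.sliceCoercive_gaugeAct_iff`: the rotation is a linear isometry of the
slice).  So the chain is re-keyed on (1.9) (dag-n12-w5 g4's `_ofCoercive` editions, `B15Prop1CoerciveOfFun` …) and THIS MODULE supplies its letter `hcoer` at EVERY
regular base field from the package (N) asked ONLY at the base fields whose extended datum is near `1` on a region parallelepiped: a regular `V_k` is moved by
dag-n12-w6's composite normaliser `ũ` (§7 of `B15Prop1DatumGaugeNormalisation`: `ũ = 1` on `Λ^{(k)}`, the extension follows, `Ṽ(V_k^{ũ}) = Ṽ(V_k)^{ũ}` is near `1` on the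
region box, the (1.74) guard is kept), the package (N) at `V_k^{ũ}` gives `h17` there (J-C v1.2's `h17Clause_of_nearFlatLetters_sub_loc`), hence (1.9) there, hence
(1.9) at `V_k` by the orbit invariance.

CONTENTS (theorems only; no `def`, no `instance`, no `sorry`).
* §0 `hessian_coercive_of_h17_ofDec` — the lane's `hessian_coercive_of_h17` ((1.7) + (1.67) + (1.8) ⇒ (1.9)), which elaborates under `Classical.propDecidable`, bridged to an
  arbitrary `DecidableEq` instance on bonds by the chain's `hcl` device (`subst`).
* §1 ★ `sliceCoercive_of_nearFlatLetters_sub_loc` — ONE instance, ONE base field: J-C v1.2's package (N) (twist + localised edition) + the numerics `hsm`∕`hγle` ⇒ (1.9) at the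
  slice of `ext V_k` for print's function `fun177std (bgMSCoPOfRecord F 2 ν Kt k (maxDomT ν.M₁ Z)) ν.M₁ Z k`.
* §2 ★★ `sliceCoercive_of_normalised` — any gauge-invariant `f`, one instance's box objects: (1.9) at EVERY base field of the (1.74) guard follows from (1.9) at the guarded
  base fields whose extended datum is `ρ`-near `1` on the region box `boxBonds LO HI` (`ρ` at least dag-n12-w6's §7 constant times the guard `ε`);
  `sliceCoercive_fun177std_bgMSCoPOfRecord_of_normalised` — the same at the background of record (value invariance unconditional, `B15Eq177ValueInvarianceCoDiv`);
  ★★ `sliceCoercive_of_gaugeNormalisable` — the general-region edition: an arbitrary bond set `𝒞`, the normaliser's existence (`u = 1` on `Λ^{(k)}` and at the shell corner,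
  `Ṽ(V)^u` `ρ`-near `1` on `𝒞`) DISPLAYED as the hypothesis `hgauge` (dag-n12-w6's box theorem is one producer; a general block-union normaliser plugs in here).
* §3 ★★★ `hcoer_of_nearFlatLettersNormalised_sub_loc` — THE FAMILY LETTER `hcoer` of the `_ofCoercive` chain (dag-n12-w5 g4, binder verbatim) from: J-C v1.2's `hNF` body asked
  only for guarded `V_k` with `∀ b ∈ boxBonds (LO i) (HI i), dist1 (ext i V_k b) ≤ ρn i` (`hNFn`), per-instance region boxes `[LO i, HI i] ⊇ [lo i − 1, hi i + 1]` with
  plaquettes in `Z_i^{(k)}`, `hρn`, the numerics `hsm`∕`hγle`, `hfar`, the Schur size `K`.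
* §4 ★★★ `exists_domain_prop1Printed_lfVarOn_std_su2_box_intrinsic_analytic_atZSeqCoPRecord_ofThm1TorusClass_ofMinimiserFamilyCompact_ofNearFlatLettersNormalised_sub_loc_ofCoercive` —
  THE ASSEMBLED ENDPOINT OF THE COERCIVITY ROAD (J-C-coer): dag-n12-w5 g4's coercive record endpoint `B15Prop1CoerciveEdition.…_ofMinimiserFamilyCompact_ofCoercive` with `hcoer` supplied
  by §3 — Proposition 1 at print's (1.74) object from (J0′) `hMinC` and the package (N) at the normalised data; J-C v1.2's binder list with `hNF ↦ hNFn` and the region-box block added.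

* §5 (v1.1) ★★★ `hcoer_of_nearFlatLettersGaugeNormalisable_sub_loc`, ★★★ `…_ofMinimiserFamilyCompact_ofNearFlatLettersGaugeNormalisable_sub_loc_ofCoercive` — the GENERAL-REGION editions of
  §3∕§4: the region parallelepiped replaced by the displayed normaliser letter `hgauge` on an arbitrary bond set `𝒞 i` (LOCATED-GEOM made a hypothesis; box components discharge it by
  dag-n12-w6's §7).

LOCATED-GEOM (honest, not repaired here).  `sliceCoercive_of_normalised` and §3 ask for a region PARALLELEPIPED `[LO, HI]` whose plaquettes lie in `Z^{(k)}` (dag-n12-w6's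
normaliser is the corner axial gauge of a box); the producers of (N) want the datum near `1` around the `k`-shadow of `Ω₁(Z)`'s collar, so the knit needs `Z^{(k)}` to contain a box
around that shadow — immediate when the component of print's `Z` carrying the instance is a parallelepiped (p. 192: `Z′_k` and `Λ` of (1.73) are; (1.74) is *«defined in each component of
Z separately»*), a genuine hypothesis for a general block union; `sliceCoercive_of_gaugeNormalisable` keeps the transport with the normaliser's existence displayed for that case.

HONEST SCOPE: composition by name of landed theorems; every letter of (N) stays DISPLAYED (now at normalised data only); nothing of Bałaban's is asserted.
-/

noncomputable section

open Set Finset Metric Filter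
open scoped BigOperators Matrix RealInnerProductSpace Real InnerProductSpace Topology

namespace Literature.MathematicalPhysics.QuantumFieldTheory.Balaban1983to89.B15Prop1CoerciveAtNormalisedDatum


open B15DeterminingSets GaugeField B16Sect1Backgrounds B15Prop1Carrier B8Eq17ClassAkV1 BlockAveraging
open B15Prop1SliceTaylorCalculus B15Prop1OneSidedIneq17OfFun
open B15Prop1EndpointNearFlatLetters (h17Clause_of_nearFlatLetters_sub_loc)
open B15Prop1DatumGaugeNormalisation (exists_gauge_normalising_extend_shellGauged sliceCoercive_gaugeAct_iff)
open T4ReTrLipUnitary (plaqSmallOn_gaugeAct_iff)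
open B15Prop1ChartCalculusSU2 (E3)
open T4CubeChartGnomonic (SU2)
open B15Prop1ChartSU2 (su2Chart)
open B15Prop1SliceCoordinates (GaugeSlice ιA freeBonds)
open B15Prop1AnalyticExtClause (cplxVec anExt)
open T4AdjointCovarianceUnitary (lieSU)
open T4AxialGaugeSmallField (castSite boxPlaqs boxBonds)
open B6BondElimination (unitVec)
open B6TreeGaugePoincare (curl)
open B16Eq18Proof (box mem_box)
open B15Extension193 (extend)
open B15ShellGauge193 (shellGauge)
open B14.Eq213MaximalDomains (side)
open B14.Eq213DetSet B14.Eq216Concrete B15Sect1Instances B15Eq177GaugeInvariance B15Eq177ValueInvariance B15Eq177ValueInvarianceCoDiv B16Sect1Wilson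
open B14.Eq22Determines (blockIter IsBlockUnion)
open Literature.MathematicalPhysics.QuantumFieldTheory.BalabanImbrieJaffe1984to88.BIJ85Eq453GaugeField
open Node00 (expChart msChart constrCard)
open T4Continuum
open scoped Matrix.Norms.L2Operator


/-! ## §0  The (1.9) step of the lane's chain at an arbitrary `DecidableEq` instance on bonds -/

section Dec

variable {P : Params}

/-- **(1.7) + (1.67) + (1.8) ⇒ (1.9), AT ANY DECIDABILITY INSTANCE ON BONDS.**  The lane's `B15Prop1OneSidedIneq17OfFun.hessian_coercive_of_h17` (the γ₀-generic one-sided (1.7)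
`h17` with `hsm`∕`hγle` gives `(γ∕M⁵)‖u‖² ≤ ⟪u, D(∇g)(0) u⟫` through print's `x₁`-axial (1.8), `B15Prop1SliceIneq18.ineq19_slice_of_17`) elaborates under `Classical.propDecidable`;
this is the same statement at an arbitrary instance `hdec` on bonds, by the chain's `hcl` device (the instances form a subsingleton; a consumer at the tree's ambient instance writes
`(hdec := inferInstance) (Subsingleton.elim _ _)`). [cite: Balaban1989LargeFieldII, p.357, (1.7)–(1.9) p.358] -/
theorem hessian_coercive_of_h17_ofDec [hdec : ∀ j, DecidableEq (PBond P j)] (hcl : hdec = fun _ a b => Classical.propDecidable (a = b))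
    (hd3 : 3 ≤ P.d) (h0 : 0 < P.d) {k : ℕ} {Λ : Set (Site P 0)} {T : Finset (PBond P k)}
    {lo hi : Fin P.d → ℤ} (hbox : pts k Λ = (castSite '' Set.Icc lo hi : Set (Site P k)))
    (hTG0 : T = (box (fun κ => (hi κ - lo κ + 1).toNat) lo).image fun x => (⟨castSite (x - unitVec ⟨0, h0⟩), ⟨0, h0⟩⟩ : PBond P k))
    (hN5 : ∀ κ, ((hi κ - lo κ + 1).toNat : ℤ) + 5 < P.sitesPerDir k) {K : ℕ} (hK1 : 1 ≤ K) (hKn : ∀ κ, (hi κ - lo κ + 1).toNat ≤ K)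
    {γ M Cerr γ₀ : ℝ} (hγ₀ : 0 ≤ γ₀) (g : GaugeSlice (pts k Λ) T E3 → ℝ)
    (h17 : ∀ X : GaugeSlice (pts k Λ) T E3,
      γ₀ * (∑ z ∈ box (fun κ => (hi κ - lo κ + 1).toNat + 3) (fun κ => lo κ - 2), ∑ μ : Fin P.d, ∑ a : Fin 3,
          curl (fun b => ιA (pts k Λ) T X (⟨castSite b.1, b.2⟩ : PBond P k) a) z ⟨0, h0⟩ μ ^ 2) -
        Cerr * ‖X‖ ^ 2 ≤ ⟪X, (fderiv ℝ (rGrad (pts k Λ) T g) 0) X⟫)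
    (hsm : Cerr ≤ γ₀ / (2 * (3 * (K : ℝ) ^ 2 + 2 * (K : ℝ) ^ 4)))
    (hγle : γ / M ^ 5 ≤ γ₀ / (2 * (3 * (K : ℝ) ^ 2 + 2 * (K : ℝ) ^ 4))) (u : GaugeSlice (pts k Λ) T E3) :
    γ / M ^ 5 * ‖u‖ ^ 2 ≤ ⟪u, fderiv ℝ (rGrad (pts k Λ) T g) 0 u⟫_ℝ := by
  subst hcl
  exact hessian_coercive_of_h17 hd3 h0 hbox hTG0 hN5 hK1 hKn hγ₀ g h17 hsm hγle u

end Dec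

/-! ## §1  One instance, one base field: the package (N) gives (1.9) at the slice -/

section OneField

variable {F : T4Family}

/-- ★ **(1.9) AT THE SLICE OF ONE BASE FIELD FROM THE NEAR-FLAT PACKAGE (N)** (twist + localised edition, the objects of J-C v1.2's `h17Clause_of_nearFlatLetters_sub_loc`:
background `bgMSCoPOfRecord F 2 ν Kt k (maxDomT ν.M₁ Z)` at the class of record, determining set `𝐁_k(Z)`, slice `GaugeSlice (pts k Λ) T E3` over print's box `Λ^{(k)} = castSite '' [lo, hi]`
with the `x₁`-axial tree `G₀`, extended base field `ext V_k`).  From (N) — `U₀` near-flat on the plaquettes having a bond that starts in `Ω₁(Z)`, the real `C²` family `X_f` of (2.12)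
minimisers in the exponential chart at `U₀`, the linearised letters `Ψ₂`, `λ`, `p`, `q`, `L♭`, `R♭`, and per slice vector (δ₂), (μ), (K), the Federbush fibre letter with the twist defect
`τ` — and the numerics `hsm` (the assembled `Cerr` is small) and `hγle` (the positivity constant fits): `γ∕M⁵·‖X‖² ≤ ⟪X, D(∇ sliceFn … (ext V_k))(0) X⟫` for EVERY slice vector `X`.
Proof: J-C v1.2's clause gives the one-sided (1.7) `h17` for every `X`, and §0 ((1.67) + (1.8)) gives (1.9). [cite: Balaban1989LargeFieldII, p.357, (1.7)–(1.9) p.358, (1.12)–(1.13) p.359; Balaban1989LargeFieldI, (1.74) p.192, (1.77) and Prop. 1 p.194; Balaban1985Variational, (47) p.285, (81) p.290, Prop. 9 (190) p.309; Balaban1988Convergent, (2.2) p.255, (2.12)–(2.13) pp.256–257] -/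
theorem sliceCoercive_of_nearFlatLetters_sub_loc (ν : Node00.Stage7Numerics) (Kt : ℕ) (hd3 : 3 ≤ (F.P Kt).d) (h0 : 0 < (F.P Kt).d)
    {k : ℕ} (hk0 : 0 < k) (hk : k ≤ (F.P Kt).m + (F.P Kt).K)
    (Z Λ : Set (Site (F.P Kt) 0)) (T : Finset (PBond (F.P Kt) k))
    {lo hi : Fin (F.P Kt).d → ℤ} (hbox : pts k Λ = (castSite '' Set.Icc lo hi : Set (Site (F.P Kt) k)))
    (hTG0 : T = (box (fun κ => (hi κ - lo κ + 1).toNat) lo).image fun x => (⟨castSite (x - unitVec ⟨0, h0⟩), ⟨0, h0⟩⟩ : PBond (F.P Kt) k))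
    (hN5 : ∀ κ, ((hi κ - lo κ + 1).toNat : ℤ) + 5 < (F.P Kt).sitesPerDir k) {K : ℕ} (hK1 : 1 ≤ K) (hKn : ∀ κ, (hi κ - lo κ + 1).toNat ≤ K)
    (ext : GaugeField (F.P Kt) k SU2 → GaugeField (F.P Kt) k SU2) (Vk : GaugeField (F.P Kt) k SU2)
    (hfar : ∀ b : PBond (F.P Kt) 0, b.src ∉ maxDomT ν.M₁ Z 1 → (⟨blockIter k b.src, b.dir⟩ : PBond (F.P Kt) k) ∉ bondsOf (pts k Λ))
    {γ M γ₀ δ μ ρ δ₂ Kc τ : ℝ} (hγ₀ : 0 ≤ γ₀) (hδ0 : 0 ≤ δ) (hμ0 : 0 ≤ μ) (hρ0 : 0 ≤ ρ) (hδ₂0 : 0 ≤ δ₂)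
    (U₀ : GaugeField (F.P Kt) 0 SU2)
    -- LOCALISED near-flatness: only on the plaquettes having a bond that starts in `Ω₁(Z)`
    (hU : ∀ p : Plaq (F.P Kt) 0, ((⟨p.src, p.μ⟩ : PBond (F.P Kt) 0) ∈ {b : PBond (F.P Kt) 0 | b.src ∈ maxDomT ν.M₁ Z 1} ∨
        (⟨p.src.shift p.μ, p.ν⟩ : PBond (F.P Kt) 0) ∈ {b : PBond (F.P Kt) 0 | b.src ∈ maxDomT ν.M₁ Z 1} ∨
        (⟨p.src.shift p.ν, p.μ⟩ : PBond (F.P Kt) 0) ∈ {b : PBond (F.P Kt) 0 | b.src ∈ maxDomT ν.M₁ Z 1} ∨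
        (⟨p.src, p.ν⟩ : PBond (F.P Kt) 0) ∈ {b : PBond (F.P Kt) 0 | b.src ∈ maxDomT ν.M₁ Z 1}) →
      ‖((U₀ ⟨p.src, p.μ⟩ : SU2) : Matrix (Fin 2) (Fin 2) ℂ) - 1‖ ≤ δ ∧ ‖((U₀ ⟨p.src.shift p.μ, p.ν⟩ : SU2) : Matrix (Fin 2) (Fin 2) ℂ) - 1‖ ≤ δ ∧
        ‖((U₀ ⟨p.src.shift p.ν, p.μ⟩ : SU2) : Matrix (Fin 2) (Fin 2) ℂ) - 1‖ ≤ δ ∧ ‖((U₀ ⟨p.src, p.ν⟩ : SU2) : Matrix (Fin 2) (Fin 2) ℂ) - 1‖ ≤ δ)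
    (Xf : GaugeSlice (pts k Λ) T E3 → PBond (F.P Kt) 0 → lieSU (Fin 2)) (hX₀ : Xf 0 = 0) (hXc : ContDiffAt ℝ 2 Xf 0)
    (hmin : ∀ᶠ Y in 𝓝 (0 : GaugeSlice (pts k Λ) T E3),
      IsMinimizer (Node00.avOfRecord F 2 Kt) (Node00.regMSCoPOfRecord F 2 ν Kt k (maxDomT ν.M₁ Z)) (Bj ν.M₁ Z k)
        (avgFamily (Node00.avOfRecord F 2 Kt) (qsstarGIter0 k (expMul su2Chart (ιA (pts k Λ) T Y) (ext Vk)))) (expChart U₀ (Xf Y)))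
    {Ψ₂ : (PBond (F.P Kt) 0 → lieSU (Fin 2)) →L[ℝ] (PBond (F.P Kt) 0 → lieSU (Fin 2)) →L[ℝ] (Fin (constrCard (Bj ν.M₁ Z k) k) → lieSU (Fin 2))}
    (hΨ₂ : HasFDerivAt (fun Y => fderiv ℝ (msChart F 2 Kt k (Bj ν.M₁ Z k) (avgFamily (Node00.avOfRecord F 2 Kt) (qsstarGIter0 k (ext Vk))) U₀) Y) Ψ₂ 0)
    (hΨd : ∀ᶠ Y in 𝓝 (0 : PBond (F.P Kt) 0 → lieSU (Fin 2)), DifferentiableAt ℝ (msChart F 2 Kt k (Bj ν.M₁ Z k) (avgFamily (Node00.avOfRecord F 2 Kt) (qsstarGIter0 k (ext Vk))) U₀) Y)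
    {lam : (Fin (constrCard (Bj ν.M₁ Z k) k) → lieSU (Fin 2)) →L[ℝ] ℝ}
    (hlam : fderiv ℝ (fun Y : PBond (F.P Kt) 0 → lieSU (Fin 2) => wilsonAction4 (expChart U₀ Y)) 0 =
      lam.comp (fderiv ℝ (msChart F 2 Kt k (Bj ν.M₁ Z k) (avgFamily (Node00.avOfRecord F 2 Kt) (qsstarGIter0 k (ext Vk))) U₀) 0))
    (p : Seminorm ℝ (PBond (F.P Kt) 0 → lieSU (Fin 2))) (hp : ∀ Y : PBond (F.P Kt) 0 → lieSU (Fin 2), ∑ b, ‖(Y b : Matrix (Fin 2) (Fin 2) ℂ)‖ ^ 2 ≤ p Y ^ 2)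
    (q : (Fin (constrCard (Bj ν.M₁ Z k) k) → lieSU (Fin 2)) → ℝ) (Lf : (PBond (F.P Kt) 0 → lieSU (Fin 2)) →L[ℝ] (Fin (constrCard (Bj ν.M₁ Z k) k) → lieSU (Fin 2)))
    {Rf : (Fin (constrCard (Bj ν.M₁ Z k) k) → lieSU (Fin 2)) → PBond (F.P Kt) 0 → lieSU (Fin 2)} (hRf : ∀ v, Lf (Rf v) = v) (hρ : ∀ v, p (Rf v) ≤ ρ * q v)
    -- per slice vector: (δ₂), (μ), (K) and the Federbush fibre letter with `γ₀·circ − τ‖X‖² ≤ m`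
    (hX : ∀ X : GaugeSlice (pts k Λ) T E3,
      q (fderiv ℝ (msChart F 2 Kt k (Bj ν.M₁ Z k) (avgFamily (Node00.avOfRecord F 2 Kt) (qsstarGIter0 k (ext Vk))) U₀) 0 (fderiv ℝ Xf 0 X) - Lf (fderiv ℝ Xf 0 X))
          ≤ δ₂ * p (fderiv ℝ Xf 0 X) ∧
      lam (Ψ₂ (fderiv ℝ Xf 0 X) (fderiv ℝ Xf 0 X)) ≤ μ * p (fderiv ℝ Xf 0 X) ^ 2 ∧
      p (fderiv ℝ Xf 0 X) ≤ Kc * ‖X‖ ∧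
      ∃ m : ℝ, (∀ w', Lf w' = fderiv ℝ (msChart F 2 Kt k (Bj ν.M₁ Z k) (avgFamily (Node00.avOfRecord F 2 Kt) (qsstarGIter0 k (ext Vk))) U₀) 0 (fderiv ℝ Xf 0 X) →
          m ≤ fderiv ℝ (fun Y => fderiv ℝ (fun Y : PBond (F.P Kt) 0 → lieSU (Fin 2) => wilsonAction4 (expChart (1 : GaugeField (F.P Kt) 0 SU2) Y)) Y) 0 w' w') ∧
        γ₀ * (∑ z ∈ box (fun κ => (hi κ - lo κ + 1).toNat + 3) (fun κ => lo κ - 2), ∑ μ : Fin (F.P Kt).d, ∑ a : Fin 3,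
            curl (fun b => ιA (pts k Λ) T X (⟨castSite b.1, b.2⟩ : PBond (F.P Kt) k) a) z ⟨0, h0⟩ μ ^ 2) - τ * ‖X‖ ^ 2 ≤ m)
    -- numerics: the assembled `Cerr` (with the twist defect `τ`) is small, and the positivity constant fits
    (hsm : (32 * (((F.P Kt).d : ℝ) - 1) * δ + μ + 16 * (((F.P Kt).d : ℝ) - 1) * (ρ * δ₂) * (2 + ρ * δ₂)) * Kc ^ 2 + τ
      ≤ γ₀ / (2 * (3 * (K : ℝ) ^ 2 + 2 * (K : ℝ) ^ 4)))
    (hγle : γ / M ^ 5 ≤ γ₀ / (2 * (3 * (K : ℝ) ^ 2 + 2 * (K : ℝ) ^ 4)))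
    (X : GaugeSlice (pts k Λ) T E3) :
    γ / M ^ 5 * ‖X‖ ^ 2
      ≤ ⟪X, fderiv ℝ (rGrad (pts k Λ) T (sliceFn (pts k Λ) T (fun177std (Node00.bgMSCoPOfRecord F 2 ν Kt k (maxDomT ν.M₁ Z)) ν.M₁ Z k) (ext Vk))) 0 X⟫_ℝ :=
  hessian_coercive_of_h17_ofDec (hdec := inferInstance) (Subsingleton.elim _ _) hd3 h0 hbox hTG0 hN5 hK1 hKn hγ₀
    (sliceFn (pts k Λ) T (fun177std (Node00.bgMSCoPOfRecord F 2 ν Kt k (maxDomT ν.M₁ Z)) ν.M₁ Z k) (ext Vk))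
    (fun X => h17Clause_of_nearFlatLetters_sub_loc ν Kt hk0 hk Z Λ T ext Vk hfar
      (fun X => ∑ z ∈ box (fun κ => (hi κ - lo κ + 1).toNat + 3) (fun κ => lo κ - 2), ∑ μ : Fin (F.P Kt).d, ∑ a : Fin 3,
        curl (fun b => ιA (pts k Λ) T X (⟨castSite b.1, b.2⟩ : PBond (F.P Kt) k) a) z ⟨0, h0⟩ μ ^ 2)
      hδ0 hμ0 hρ0 hδ₂0 U₀ hU Xf hX₀ hXc hmin hΨ₂ hΨd hlam p hp q Lf hRf hρ hX X)
    hsm hγle X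

end OneField

/-! ## §2  The orbit transport: (1.9) at every regular base field from (1.9) at the gauge-normalised ones -/

section Transport

variable {P : Params}

/-- ★★ **(1.9) AT EVERY REGULAR BASE FIELD FROM (1.9) AT THE NORMALISED ONES** (any gauge-invariant `f`; the objects of one Prop-1 instance: the box `Λ^{(k)} = castSite '' [lo, hi]`
of at most `n + 1` sites per direction, non-wrapping, its enlarged box's plaquettes in `Z^{(k)}`, `d ≥ 3`; a REGION parallelepiped `[LO, HI] ⊇ [lo − 1, hi + 1]` of at most `n′ + 1`
sites per direction, non-wrapping, plaquettes in `Z^{(k)}`; print's p. 193 extension `ext V = extend Λ^{(k)} (shellGauge V lo hi) V`; any tree `T`).  HYPOTHESIS `hnorm`: (1.9) with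
constant `γ′` holds at the slice of `ext V` for every base field `V` of the (1.74) guard `PlaqSmallOn (plaqsInside (Z ∩ Λᶜ)^{(k)}) ε` WHOSE EXTENDED DATUM IS `ρ`-NEAR `1` ON EVERY BOND
OF THE REGION BOX, `ρ ≥ (d·n′ + 1)·((d − 1)n′·(12d(n + 2)² + 1) + 3d(n + 2)²)·ε`.  CONCLUSION: (1.9) with the same constant at the slice of `ext V` for EVERY `V` of the guard.
Proof — p. 194's orbit sentence made quantitative: dag-n12-w6's composite normaliser `ũ` of `V` (`B15Prop1DatumGaugeNormalisation.exists_gauge_normalising_extend_shellGauged`: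
`V^{ũ}` is in the guard again by `plaqSmallOn_gaugeAct_iff`, `Ṽ(V^{ũ}) = Ṽ(V)^{ũ}`, and `Ṽ(V)^{ũ}` is `ρ`-near `1` on the region box), `hnorm` at `V^{ũ}`, and the orbit
invariance of (1.9) (`sliceCoercive_gaugeAct_iff`: the slice function at `Ṽ^{ũ}` is the one at `Ṽ` precomposed with a linear isometry).
[cite: Balaban1989LargeFieldI, p.193, (1.77) and the sentence after it p.194; Balaban1989LargeFieldII, (1.9) p.358, p.359] -/
theorem sliceCoercive_of_normalised (hd : 3 ≤ P.d) {k : ℕ} {lo hi : Fin P.d → ℤ} (hlohi : lo ≤ hi) {n : ℕ}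
    (hn : ∀ κ, hi κ ≤ lo κ + n) (hN : ∀ κ, hi κ - lo κ + 3 < (P.sitesPerDir k : ℤ)) {Z Λ : Set (Site P 0)}
    (hbox : pts k Λ = (castSite '' Set.Icc lo hi : Set (Site P k)))
    (hZ : (boxPlaqs (lo - 1) (hi + 1) : Set (Plaq P k)) ⊆ plaqsInside (pts k Z))
    {LO HI : Fin P.d → ℤ} (hLO : LO ≤ lo - 1) (hHI : hi + 1 ≤ HI) {n' : ℕ} (hn' : ∀ κ, HI κ ≤ LO κ + n')
    (hn'N : n' < P.sitesPerDir k) (hR : (boxPlaqs LO HI : Set (Plaq P k)) ⊆ plaqsInside (pts k Z))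
    {ε : ℝ} (hε : 0 < ε) {ρ : ℝ}
    (hρ : ((P.d : ℝ) * n' + 1) * (((P.d - 1 : ℕ) : ℝ) * n' * ((12 * P.d * (n + 2) ^ 2 + 1) * ε) + 3 * P.d * (n + 2) ^ 2 * ε) ≤ ρ)
    (ext : GaugeField P k SU2 → GaugeField P k SU2) (hext : ∀ V, ext V = extend (pts k Λ) (shellGauge V lo hi) V)
    {f : GaugeField P k SU2 → ℝ} (hf : ∀ (u : GaugeTransf P k SU2) (V : GaugeField P k SU2), f (gaugeAct u V) = f V)
    (T : Finset (PBond P k)) (γ' : ℝ)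
    (hnorm : ∀ V : GaugeField P k SU2, PlaqSmallOn (plaqsInside (pts k (Z ∩ Λᶜ))) ε V →
      (∀ b ∈ (boxBonds LO HI : Set (PBond P k)), dist1 (ext V b) ≤ ρ) →
      ∀ X : GaugeSlice (pts k Λ) T E3, γ' * ‖X‖ ^ 2 ≤ ⟪X, fderiv ℝ (rGrad (pts k Λ) T (sliceFn (pts k Λ) T f (ext V))) 0 X⟫_ℝ)
    (V : GaugeField P k SU2) (hV : PlaqSmallOn (plaqsInside (pts k (Z ∩ Λᶜ))) ε V) (X : GaugeSlice (pts k Λ) T E3) :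
    γ' * ‖X‖ ^ 2 ≤ ⟪X, fderiv ℝ (rGrad (pts k Λ) T (sliceFn (pts k Λ) T f (ext V))) 0 X⟫_ℝ := by
  -- dag-n12-w6's composite normaliser of `V`
  obtain ⟨u', ũ, -, -, -, -, hcomm, hnear⟩ :=
    exists_gauge_normalising_extend_shellGauged (G := SU2) hd hlohi hn hN hbox hZ hLO hHI hn' hn'N hR hε hV
  -- the normalised base field is in the guard, its extension is `Ṽ(V)^{ũ}`, near `1` on the region box
  have hV' : PlaqSmallOn (plaqsInside (pts k (Z ∩ Λᶜ))) ε (gaugeAct ũ V) := (plaqSmallOn_gaugeAct_iff _ _ ũ V).2 hV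
  have hext' : ext (gaugeAct ũ V) = gaugeAct ũ (ext V) := by
    rw [hext, hext, hcomm]
  have hn'' : ∀ b ∈ (boxBonds LO HI : Set (PBond P k)), dist1 (ext (gaugeAct ũ V) b) ≤ ρ := fun b hb => by
    rw [hext', hext V]
    exact (hnear b hb).trans hρ
  -- (1.9) at the normalised datum, transported along the orbit
  have h := hnorm (gaugeAct ũ V) hV' hn''
  rw [hext'] at h
  exact (sliceCoercive_gaugeAct_iff (pts k Λ) T hf ũ (ext V) γ').1 h X

/-- ★★ **THE SAME AT THE BACKGROUND OF RECORD** (`f = fun177std (bgMSCoPOfRecord F 2 ν Kt k′ Ω) M₁ Z′ k`, `k ≤ m + K` — print's function of the lane's endpoints; its gauge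
invariance is unconditional, `B15Eq177ValueInvarianceCoDiv.fun177std_bgMSCoPOfRecord_gaugeAct`). [cite: Balaban1989LargeFieldI, p.193, (1.77) and the sentence after it p.194; Balaban1989LargeFieldII, (1.9) p.358] -/
theorem sliceCoercive_fun177std_bgMSCoPOfRecord_of_normalised {F : T4Family} (ν : Node00.Stage7Numerics) (Kt k' : ℕ)
    (Ω : ℕ → Set (Site (F.P Kt) 0)) (M₁ : ℕ) (Z' : Set (Site (F.P Kt) 0))
    (hd : 3 ≤ (F.P Kt).d) {k : ℕ} (hk : k ≤ (F.P Kt).m + (F.P Kt).K) {lo hi : Fin (F.P Kt).d → ℤ} (hlohi : lo ≤ hi) {n : ℕ}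
    (hn : ∀ κ, hi κ ≤ lo κ + n) (hN : ∀ κ, hi κ - lo κ + 3 < ((F.P Kt).sitesPerDir k : ℤ)) {Z Λ : Set (Site (F.P Kt) 0)}
    (hbox : pts k Λ = (castSite '' Set.Icc lo hi : Set (Site (F.P Kt) k)))
    (hZ : (boxPlaqs (lo - 1) (hi + 1) : Set (Plaq (F.P Kt) k)) ⊆ plaqsInside (pts k Z))
    {LO HI : Fin (F.P Kt).d → ℤ} (hLO : LO ≤ lo - 1) (hHI : hi + 1 ≤ HI) {n' : ℕ} (hn' : ∀ κ, HI κ ≤ LO κ + n')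
    (hn'N : n' < (F.P Kt).sitesPerDir k) (hR : (boxPlaqs LO HI : Set (Plaq (F.P Kt) k)) ⊆ plaqsInside (pts k Z))
    {ε : ℝ} (hε : 0 < ε) {ρ : ℝ}
    (hρ : (((F.P Kt).d : ℝ) * n' + 1) * ((((F.P Kt).d - 1 : ℕ) : ℝ) * n' * ((12 * (F.P Kt).d * (n + 2) ^ 2 + 1) * ε) + 3 * (F.P Kt).d * (n + 2) ^ 2 * ε) ≤ ρ)
    (ext : GaugeField (F.P Kt) k SU2 → GaugeField (F.P Kt) k SU2) (hext : ∀ V, ext V = extend (pts k Λ) (shellGauge V lo hi) V)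
    (T : Finset (PBond (F.P Kt) k)) (γ' : ℝ)
    (hnorm : ∀ V : GaugeField (F.P Kt) k SU2, PlaqSmallOn (plaqsInside (pts k (Z ∩ Λᶜ))) ε V →
      (∀ b ∈ (boxBonds LO HI : Set (PBond (F.P Kt) k)), dist1 (ext V b) ≤ ρ) →
      ∀ X : GaugeSlice (pts k Λ) T E3, γ' * ‖X‖ ^ 2
        ≤ ⟪X, fderiv ℝ (rGrad (pts k Λ) T (sliceFn (pts k Λ) T (fun177std (Node00.bgMSCoPOfRecord F 2 ν Kt k' Ω) M₁ Z' k) (ext V))) 0 X⟫_ℝ)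
    (V : GaugeField (F.P Kt) k SU2) (hV : PlaqSmallOn (plaqsInside (pts k (Z ∩ Λᶜ))) ε V) (X : GaugeSlice (pts k Λ) T E3) :
    γ' * ‖X‖ ^ 2 ≤ ⟪X, fderiv ℝ (rGrad (pts k Λ) T (sliceFn (pts k Λ) T (fun177std (Node00.bgMSCoPOfRecord F 2 ν Kt k' Ω) M₁ Z' k) (ext V))) 0 X⟫_ℝ :=
  sliceCoercive_of_normalised hd hlohi hn hN hbox hZ hLO hHI hn' hn'N hR hε hρ ext hext
    (fun u W => fun177std_bgMSCoPOfRecord_gaugeAct ν Kt k' Ω M₁ Z' hk u W) T γ' hnorm V hV X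

/-- ★★ **THE GENERAL-REGION EDITION: (1.9) AT EVERY REGULAR BASE FIELD FROM (1.9) AT THE GAUGE-NORMALISABLE ONES** — the orbit transport of `sliceCoercive_of_normalised` with
the normaliser's EXISTENCE displayed as a hypothesis instead of taken from dag-n12-w6's box theorem: for an ARBITRARY set `𝒞` of `k`-bonds and tolerance `ρ`, if every base field `V`
of the (1.74) guard admits a gauge transformation `u` of `T^{(k)}` with `u = 1` on `Λ^{(k)}`, `u(c₀) = 1` at the shell corner `c₀ = castSite (lo − 1)` (so that the p. 193 extension
follows, `Ṽ(V^u) = Ṽ(V)^u`, `B15Prop1DatumGaugeNormalisation.extend_gaugeAct_of_eq_one`) and `Ṽ(V)^u` `ρ`-near `1` on `𝒞` (`hgauge`), and (1.9) holds at the slice of `ext V` for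
the guarded `V` with `Ṽ(V)` `ρ`-near `1` on `𝒞` (`hnorm`), then (1.9) holds at the slice of `ext V` for EVERY guarded `V`.  (For `𝒞 = boxBonds LO HI` inside `Z^{(k)}` the
hypothesis `hgauge` is dag-n12-w6's `exists_gauge_normalising_extend_shellGauged`; a normaliser on a general block union plugs in here.)
[cite: Balaban1989LargeFieldI, p.193, (1.77) and the sentence after it p.194; Balaban1989LargeFieldII, (1.9) p.358] -/
theorem sliceCoercive_of_gaugeNormalisable {k : ℕ} {lo hi : Fin P.d → ℤ}
    (hN : ∀ κ, hi κ - lo κ + 3 < (P.sitesPerDir k : ℤ)) {Z Λ : Set (Site P 0)}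
    (hbox : pts k Λ = (castSite '' Set.Icc lo hi : Set (Site P k))) {ε : ℝ}
    (ext : GaugeField P k SU2 → GaugeField P k SU2) (hext : ∀ V, ext V = extend (pts k Λ) (shellGauge V lo hi) V)
    {f : GaugeField P k SU2 → ℝ} (hf : ∀ (u : GaugeTransf P k SU2) (V : GaugeField P k SU2), f (gaugeAct u V) = f V)
    (T : Finset (PBond P k)) (γ' : ℝ) (𝒞 : Set (PBond P k)) (ρ : ℝ)
    (hgauge : ∀ V : GaugeField P k SU2, PlaqSmallOn (plaqsInside (pts k (Z ∩ Λᶜ))) ε V →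
      ∃ u : GaugeTransf P k SU2, (∀ s ∈ pts k Λ, u s = 1) ∧ u (castSite (lo - 1)) = 1 ∧ ∀ b ∈ 𝒞, dist1 (gaugeAct u (ext V) b) ≤ ρ)
    (hnorm : ∀ V : GaugeField P k SU2, PlaqSmallOn (plaqsInside (pts k (Z ∩ Λᶜ))) ε V →
      (∀ b ∈ 𝒞, dist1 (ext V b) ≤ ρ) →
      ∀ X : GaugeSlice (pts k Λ) T E3, γ' * ‖X‖ ^ 2 ≤ ⟪X, fderiv ℝ (rGrad (pts k Λ) T (sliceFn (pts k Λ) T f (ext V))) 0 X⟫_ℝ)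
    (V : GaugeField P k SU2) (hV : PlaqSmallOn (plaqsInside (pts k (Z ∩ Λᶜ))) ε V) (X : GaugeSlice (pts k Λ) T E3) :
    γ' * ‖X‖ ^ 2 ≤ ⟪X, fderiv ℝ (rGrad (pts k Λ) T (sliceFn (pts k Λ) T f (ext V))) 0 X⟫_ℝ := by
  obtain ⟨u, huΛ, hu₀, hnear⟩ := hgauge V hV
  -- the normalised base field is in the guard and its extension is `Ṽ(V)^u`
  have hV' : PlaqSmallOn (plaqsInside (pts k (Z ∩ Λᶜ))) ε (gaugeAct u V) := (plaqSmallOn_gaugeAct_iff _ _ u V).2 hV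
  have hext' : ext (gaugeAct u V) = gaugeAct u (ext V) := by
    rw [hext, hext]
    have h := B15Prop1DatumGaugeNormalisation.extend_gaugeAct_of_eq_one (lo := lo) (hi := hi) hN u V
      (by rw [← hbox]; exact huΛ) hu₀
    rw [← hbox] at h
    exact h
  have hn'' : ∀ b ∈ 𝒞, dist1 (ext (gaugeAct u V) b) ≤ ρ := fun b hb => by
    rw [hext']
    exact hnear b hb
  -- (1.9) at the normalised datum, transported along the orbit
  have h := hnorm (gaugeAct u V) hV' hn''
  rw [hext'] at h
  exact (sliceCoercive_gaugeAct_iff (pts k Λ) T hf u (ext V) γ').1 h X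

end Transport

/-! ## §3  The family letter `hcoer` of the `_ofCoercive` chain from the package (N) at the normalised data -/

section Family

variable {F : T4Family}

/-- ★★★ **THE (1.9) LETTER `hcoer` OF THE `_ofCoercive` CHAIN, FROM THE NEAR-FLAT PACKAGE (N) ASKED ONLY AT THE GAUGE-NORMALISED BASE FIELDS.**  Objects: the lane's family of Prop-1
instances at print's (1.74) object (background `bgMSCoPOfRecord F 2 ν Kt (k i) (maxDomT ν.M₁ (Z i))`, box `Λ_i^{(k)} = castSite '' [lo i, hi i]`, `x₁`-axial tree `T i = G₀`, Schur size
`K i`, p. 193 extension `ext i`), plus per instance a REGION parallelepiped `[LO i, HI i] ⊇ [lo i − 1, hi i + 1]` of at most `n′ i + 1` sites per direction, non-wrapping, with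
plaquettes in `Z_i^{(k)}`, and a datum tolerance `ρn i ≥ (d·n′ i + 1)·((d − 1)n′ i·(12d(n i + 2)² + 1) + 3d(n i + 2)²)·eR i`.  LETTER `hNFn`: J-C v1.2's package (N) (twist + localised
edition, body VERBATIM) for instance `i` and base field `V_k`, asked only when `V_k` is in the strict (1.74) guard AND `dist1 (ext i V_k b) ≤ ρn i` on every bond `b` of the region
box.  With the numerics `hsm`∕`hγle` and `hfar`: for EVERY instance and EVERY base field of the guard, (1.9) `γ∕(M i)⁵·‖X‖² ≤ ⟪X, D(∇ sliceFn … (ext i V_k))(0) X⟫` for all slice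
vectors — the letter `hcoer` of dag-n12-w5's `B15Prop1CoerciveOfFun.exists_domain_prop1Printed_lfVarOn_ofFun_intrinsic_analytic_ofCoercive` and of its record layers at
`f i := fun177std (bgMSCoPOfRecord F 2 ν Kt (k i) (maxDomT ν.M₁ (Z i))) ν.M₁ (Z i) (k i)`, binder for binder.  Proof: §2 at the background of record with `hnorm` supplied by §1 on
the output of `hNFn`. [cite: Balaban1989LargeFieldI, (1.74) p.192, p.193, (1.77) and the sentence after it, Prop. 1 p.194; Balaban1989LargeFieldII, p.357, (1.7)–(1.9) p.358, (1.12)–(1.13) p.359;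
Balaban1985Variational, (47) p.285, (81) p.290, Prop. 9 (190) p.309; Balaban1988Convergent, (2.2) p.255, (2.12)–(2.13) pp.256–257] -/
theorem hcoer_of_nearFlatLettersNormalised_sub_loc
    (ν : Node00.Stage7Numerics) (Kt : ℕ) (hd3 : 3 ≤ (F.P Kt).d) (h0 : 0 < (F.P Kt).d) {ι : Type}
    (Z Λ : ι → Set (Site (F.P Kt) 0)) (k : ι → ℕ) (M : ι → ℝ) (hk0 : ∀ i, 0 < k i) (hk : ∀ i, k i ≤ (F.P Kt).m + (F.P Kt).K)
    (eR : ι → ℝ) (heR : ∀ i, 0 < eR i)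
    (T : ∀ i, Finset (PBond (F.P Kt) (k i)))
    (lo hi : ι → Fin (F.P Kt).d → ℤ) (n : ι → ℕ) (hn : ∀ i κ, hi i κ ≤ lo i κ + n i)
    (hbox : ∀ i, pts (k i) (Λ i) = (castSite '' Set.Icc (lo i) (hi i) : Set (Site (F.P Kt) (k i))))
    (hZ : ∀ i, (boxPlaqs (lo i - 1) (hi i + 1) : Set (Plaq (F.P Kt) (k i))) ⊆ plaqsInside (pts (k i) (Z i)))
    (hTG0 : ∀ i, T i = (box (fun κ => (hi i κ - lo i κ + 1).toNat) (lo i)).image fun x =>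
      (⟨castSite (x - unitVec ⟨0, h0⟩), ⟨0, h0⟩⟩ : PBond (F.P Kt) (k i)))
    (hN5 : ∀ i κ, ((hi i κ - lo i κ + 1).toNat : ℤ) + 5 < (F.P Kt).sitesPerDir (k i))
    (K : ι → ℕ) (hK1 : ∀ i, 1 ≤ K i) (hKn : ∀ i κ, (hi i κ - lo i κ + 1).toNat ≤ K i)
    (ext : ∀ i, GaugeField (F.P Kt) (k i) SU2 → GaugeField (F.P Kt) (k i) SU2)
    (hext : ∀ i Vk, ext i Vk = extend (pts (k i) (Λ i)) (shellGauge Vk (lo i) (hi i)) Vk)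
    (hlohi : ∀ i, lo i ≤ hi i)
    -- the REGION parallelepipeds of the normalisation and the datum tolerances
    (LO HI : ι → Fin (F.P Kt).d → ℤ) (hLO : ∀ i, LO i ≤ lo i - 1) (hHI : ∀ i, hi i + 1 ≤ HI i) (n' : ι → ℕ) (hn' : ∀ i κ, HI i κ ≤ LO i κ + n' i)
    (hn'N : ∀ i, n' i < (F.P Kt).sitesPerDir (k i)) (hR : ∀ i, (boxPlaqs (LO i) (HI i) : Set (Plaq (F.P Kt) (k i))) ⊆ plaqsInside (pts (k i) (Z i)))
    (ρn : ι → ℝ)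
    (hρn : ∀ i, (((F.P Kt).d : ℝ) * n' i + 1) * ((((F.P Kt).d - 1 : ℕ) : ℝ) * n' i * ((12 * (F.P Kt).d * (n i + 2) ^ 2 + 1) * eR i)
      + 3 * (F.P Kt).d * (n i + 2) ^ 2 * eR i) ≤ ρn i)
    {γ : ℝ} {γ₀ : ℝ} (hγ₀ : 0 ≤ γ₀)
    -- (N) THE NEAR-FLAT LETTER PACKAGE per instance, asked ONLY at the guarded base fields whose extended datum is `ρn i`-near `1` on the region box
    {δc μc ρc δ₂c Kc τc : ι → ℝ} (hδc0 : ∀ i, 0 ≤ δc i) (hμc0 : ∀ i, 0 ≤ μc i) (hρc0 : ∀ i, 0 ≤ ρc i) (hδ₂c0 : ∀ i, 0 ≤ δ₂c i)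
    (hNFn : ∀ i (Vk : GaugeField (F.P Kt) (k i) SU2), PlaqSmallOn (plaqsInside (pts (k i) (Z i ∩ (Λ i)ᶜ))) (eR i) Vk →
      (∀ b ∈ (boxBonds (LO i) (HI i) : Set (PBond (F.P Kt) (k i))), dist1 (ext i Vk b) ≤ ρn i) →
      ∃ (U₀ : GaugeField (F.P Kt) 0 SU2) (Xf : GaugeSlice (pts (k i) (Λ i)) (T i) E3 → PBond (F.P Kt) 0 → lieSU (Fin 2)),
        (∀ p : Plaq (F.P Kt) 0, ((⟨p.src, p.μ⟩ : PBond (F.P Kt) 0) ∈ {b : PBond (F.P Kt) 0 | b.src ∈ maxDomT ν.M₁ (Z i) 1} ∨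
            (⟨p.src.shift p.μ, p.ν⟩ : PBond (F.P Kt) 0) ∈ {b : PBond (F.P Kt) 0 | b.src ∈ maxDomT ν.M₁ (Z i) 1} ∨
            (⟨p.src.shift p.ν, p.μ⟩ : PBond (F.P Kt) 0) ∈ {b : PBond (F.P Kt) 0 | b.src ∈ maxDomT ν.M₁ (Z i) 1} ∨
            (⟨p.src, p.ν⟩ : PBond (F.P Kt) 0) ∈ {b : PBond (F.P Kt) 0 | b.src ∈ maxDomT ν.M₁ (Z i) 1}) →
          ‖((U₀ ⟨p.src, p.μ⟩ : SU2) : Matrix (Fin 2) (Fin 2) ℂ) - 1‖ ≤ δc i ∧ ‖((U₀ ⟨p.src.shift p.μ, p.ν⟩ : SU2) : Matrix (Fin 2) (Fin 2) ℂ) - 1‖ ≤ δc i ∧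
            ‖((U₀ ⟨p.src.shift p.ν, p.μ⟩ : SU2) : Matrix (Fin 2) (Fin 2) ℂ) - 1‖ ≤ δc i ∧ ‖((U₀ ⟨p.src, p.ν⟩ : SU2) : Matrix (Fin 2) (Fin 2) ℂ) - 1‖ ≤ δc i) ∧
        Xf 0 = 0 ∧ ContDiffAt ℝ 2 Xf 0 ∧
        (∀ᶠ Y in 𝓝 (0 : GaugeSlice (pts (k i) (Λ i)) (T i) E3),
          IsMinimizer (Node00.avOfRecord F 2 Kt) (Node00.regMSCoPOfRecord F 2 ν Kt (k i) (maxDomT ν.M₁ (Z i))) (Bj ν.M₁ (Z i) (k i))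
            (avgFamily (Node00.avOfRecord F 2 Kt) (qsstarGIter0 (k i) (expMul su2Chart (ιA (pts (k i) (Λ i)) (T i) Y) (ext i Vk)))) (expChart U₀ (Xf Y))) ∧
        ∃ (Ψ₂ : (PBond (F.P Kt) 0 → lieSU (Fin 2)) →L[ℝ] (PBond (F.P Kt) 0 → lieSU (Fin 2)) →L[ℝ] (Fin (constrCard (Bj ν.M₁ (Z i) (k i)) (k i)) → lieSU (Fin 2)))
          (lam : (Fin (constrCard (Bj ν.M₁ (Z i) (k i)) (k i)) → lieSU (Fin 2)) →L[ℝ] ℝ)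
          (p : Seminorm ℝ (PBond (F.P Kt) 0 → lieSU (Fin 2))) (q : (Fin (constrCard (Bj ν.M₁ (Z i) (k i)) (k i)) → lieSU (Fin 2)) → ℝ)
          (Lf : (PBond (F.P Kt) 0 → lieSU (Fin 2)) →L[ℝ] (Fin (constrCard (Bj ν.M₁ (Z i) (k i)) (k i)) → lieSU (Fin 2)))
          (Rf : (Fin (constrCard (Bj ν.M₁ (Z i) (k i)) (k i)) → lieSU (Fin 2)) → PBond (F.P Kt) 0 → lieSU (Fin 2)),
          HasFDerivAt (fun Y => fderiv ℝ (msChart F 2 Kt (k i) (Bj ν.M₁ (Z i) (k i)) (avgFamily (Node00.avOfRecord F 2 Kt) (qsstarGIter0 (k i) (ext i Vk))) U₀) Y) Ψ₂ 0 ∧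
          (∀ᶠ Y in 𝓝 (0 : PBond (F.P Kt) 0 → lieSU (Fin 2)),
            DifferentiableAt ℝ (msChart F 2 Kt (k i) (Bj ν.M₁ (Z i) (k i)) (avgFamily (Node00.avOfRecord F 2 Kt) (qsstarGIter0 (k i) (ext i Vk))) U₀) Y) ∧
          fderiv ℝ (fun Y : PBond (F.P Kt) 0 → lieSU (Fin 2) => wilsonAction4 (expChart U₀ Y)) 0 =
            lam.comp (fderiv ℝ (msChart F 2 Kt (k i) (Bj ν.M₁ (Z i) (k i)) (avgFamily (Node00.avOfRecord F 2 Kt) (qsstarGIter0 (k i) (ext i Vk))) U₀) 0) ∧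
          (∀ Y : PBond (F.P Kt) 0 → lieSU (Fin 2), ∑ b, ‖(Y b : Matrix (Fin 2) (Fin 2) ℂ)‖ ^ 2 ≤ p Y ^ 2) ∧
          (∀ v, Lf (Rf v) = v) ∧ (∀ v, p (Rf v) ≤ ρc i * q v) ∧
          ∀ X : GaugeSlice (pts (k i) (Λ i)) (T i) E3,
            q (fderiv ℝ (msChart F 2 Kt (k i) (Bj ν.M₁ (Z i) (k i)) (avgFamily (Node00.avOfRecord F 2 Kt) (qsstarGIter0 (k i) (ext i Vk))) U₀) 0 (fderiv ℝ Xf 0 X)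
                - Lf (fderiv ℝ Xf 0 X)) ≤ δ₂c i * p (fderiv ℝ Xf 0 X) ∧
            lam (Ψ₂ (fderiv ℝ Xf 0 X) (fderiv ℝ Xf 0 X)) ≤ μc i * p (fderiv ℝ Xf 0 X) ^ 2 ∧
            p (fderiv ℝ Xf 0 X) ≤ Kc i * ‖X‖ ∧
            ∃ m : ℝ, (∀ w', Lf w' = fderiv ℝ (msChart F 2 Kt (k i) (Bj ν.M₁ (Z i) (k i)) (avgFamily (Node00.avOfRecord F 2 Kt) (qsstarGIter0 (k i) (ext i Vk))) U₀) 0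
                  (fderiv ℝ Xf 0 X) →
                m ≤ fderiv ℝ (fun Y => fderiv ℝ (fun Y : PBond (F.P Kt) 0 → lieSU (Fin 2) => wilsonAction4 (expChart (1 : GaugeField (F.P Kt) 0 SU2) Y)) Y) 0 w' w') ∧
              γ₀ * (∑ z ∈ box (fun κ => (hi i κ - lo i κ + 1).toNat + 3) (fun κ => lo i κ - 2), ∑ μ : Fin (F.P Kt).d, ∑ a : Fin 3,
                  curl (fun b => ιA (pts (k i) (Λ i)) (T i) X (⟨castSite b.1, b.2⟩ : PBond (F.P Kt) (k i)) a) z ⟨0, h0⟩ μ ^ 2) - τc i * ‖X‖ ^ 2 ≤ m)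
    -- numerics: the assembled `Cerr i` (with the twist defect `τc i`) is small, and the positivity constant fits
    (hsm : ∀ i, (32 * (((F.P Kt).d : ℝ) - 1) * δc i + μc i + 16 * (((F.P Kt).d : ℝ) - 1) * (ρc i * δ₂c i) * (2 + ρc i * δ₂c i)) * Kc i ^ 2 + τc i
      ≤ γ₀ / (2 * (3 * (K i : ℝ) ^ 2 + 2 * (K i : ℝ) ^ 4)))
    (hγle : ∀ i, γ / (M i) ^ 5 ≤ γ₀ / (2 * (3 * (K i : ℝ) ^ 2 + 2 * (K i : ℝ) ^ 4)))
    (hfar : ∀ i (b : PBond (F.P Kt) 0), b.src ∉ maxDomT ν.M₁ (Z i) 1 →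
      (⟨blockIter (k i) b.src, b.dir⟩ : PBond (F.P Kt) (k i)) ∉ bondsOf (pts (k i) (Λ i)))
    : ∀ i (Vk : GaugeField (F.P Kt) (k i) SU2), PlaqSmallOn (plaqsInside (pts (k i) (Z i ∩ (Λ i)ᶜ))) (eR i) Vk →
      ∀ X : GaugeSlice (pts (k i) (Λ i)) (T i) E3,
        γ / (M i) ^ 5 * ‖X‖ ^ 2 ≤ ⟪X, (fderiv ℝ (rGrad (pts (k i) (Λ i)) (T i)
          (sliceFn (pts (k i) (Λ i)) (T i)
            (fun177std (Node00.bgMSCoPOfRecord F 2 ν Kt (k i) (maxDomT ν.M₁ (Z i))) ν.M₁ (Z i) (k i)) (ext i Vk))) 0) X⟫_ℝ := by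
  intro i Vk hV X
  -- the box is non-wrapping with margin (from `hN5`)
  have hN : ∀ κ, hi i κ - lo i κ + 3 < ((F.P Kt).sitesPerDir (k i) : ℤ) := fun κ => by
    have h5 := hN5 i κ
    have : hi i κ - lo i κ + 1 ≤ ((hi i κ - lo i κ + 1).toNat : ℤ) := Int.self_le_toNat _
    linarith
  refine sliceCoercive_fun177std_bgMSCoPOfRecord_of_normalised ν Kt (k i) (maxDomT ν.M₁ (Z i)) ν.M₁ (Z i) hd3 (hk i) (hlohi i)
    (hn i) hN (hbox i) (hZ i) (hLO i) (hHI i) (hn' i) (hn'N i) (hR i) (heR i) (hρn i) (ext i) (hext i) (T i) (γ / (M i) ^ 5)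
    (fun V hV' hnV X' => ?_) Vk hV X
  -- (1.9) at a normalised base field from the package (N) there (§1)
  obtain ⟨U₀, Xf, hU, hX₀, hXc, hmin, Ψ₂, lam, p, q, Lf, Rf, hΨ₂, hΨd, hlam, hp, hRf, hρ, hX⟩ := hNFn i V hV' hnV
  exact sliceCoercive_of_nearFlatLetters_sub_loc ν Kt hd3 h0 (hk0 i) (hk i) (Z i) (Λ i) (T i) (hbox i) (hTG0 i) (hN5 i) (hK1 i) (hKn i)
    (ext i) V (hfar i) hγ₀ (hδc0 i) (hμc0 i) (hρc0 i) (hδ₂c0 i) U₀ hU Xf hX₀ hXc hmin hΨ₂ hΨd hlam p hp q Lf hRf hρ hX (hsm i) (hγle i) X'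

end Family

/-! ## §4  The assembled endpoint of the coercivity road: Proposition 1 at print's (1.74) object from (J0′) and the package (N) at the normalised data -/

section Endpoint

variable {F : T4Family}

/-- ★★★ **PROPOSITION 1 [IV] AT PRINT'S (1.74) OBJECT — COERCIVE ((1.9)-LETTER) ROAD — FROM (J0′) AND THE PACKAGE (N) ASKED ONLY AT THE GAUGE-NORMALISED BASE FIELDS** (J-C-coer, the
successor of J-C v1.2 `B15Prop1EndpointNearFlatLetters.…_ofNearFlatLetters_sub_loc_oneSided`): dag-n12-w5 g4's coercive record endpoint
`B15Prop1CoerciveEdition.…_ofMinimiserFamilyCompact_ofCoercive` with its (1.9) letter `hcoer` SUPPLIED by §3.  WHAT A CONSUMER SUPPLIES per instance: (J0′) `hMinC` (unchanged); the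
package (N) in the shape `hNFn` — J-C v1.2's `hNF` body VERBATIM, asked only for base fields `V_k` of the strict (1.74) guard whose extended datum is `ρn i`-near `1` on every bond of
the region parallelepiped `[LO i, HI i]`; the region boxes (`LO HI`, `[lo i − 1, hi i + 1] ⊆ [LO i, HI i]`, at most `n′ i + 1` sites per direction, `n′ i < sitesPerDir`, plaquettes in
`Z_i^{(k)}`) and tolerances `ρn i ≥ (d·n′ i + 1)·((d − 1)n′ i·(12d(n i + 2)² + 1) + 3d(n i + 2)²)·eR i`; the Schur size `K i` and the numerics `hsm`∕`hγle` (as in J-C v1.2); `hfar`, (Gᵃ)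
`hZblk`, `hM2`∕`hdiv`, the [15] letter `h15T`, structure — everything else as in J-C v1.2, binder for binder (stated at the tree's ambient decidability instance; the record endpoint is
fed with `hcl := Subsingleton.elim _ _`).  Nothing of Bałaban's is asserted.
[cite: Balaban1989LargeFieldI, (1.74) p.192, p.193, (1.77) and the sentence after it, Prop. 1 (1.77)–(1.78) p.194 (incl. the last clause), (1.79) p.195; Balaban1989LargeFieldII, p.357, (1.7)–(1.9) p.358,
(1.12)–(1.13) p.359, (1.19) p.360; Balaban1985Variational, (7) p.278, Thm 1 (8) p.279, (47) p.285, (81) p.290, Prop. 9 (190) p.309; Balaban1988Convergent, (2.2) p.255, (2.12)–(2.14) pp.256–257] -/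
theorem exists_domain_prop1Printed_lfVarOn_std_su2_box_intrinsic_analytic_atZSeqCoPRecord_ofThm1TorusClass_ofMinimiserFamilyCompact_ofNearFlatLettersNormalised_sub_loc_ofCoercive
    (ν : Node00.Stage7Numerics) (Kt : ℕ) (hd3 : 3 ≤ (F.P Kt).d) (h0 : 0 < (F.P Kt).d) {ι : Type} [Finite ι]
    (Z Λ : ι → Set (Site (F.P Kt) 0)) (k : ι → ℕ) (M : ι → ℝ) (hk0 : ∀ i, 0 < k i) (hk : ∀ i, k i ≤ (F.P Kt).m + (F.P Kt).K)
    (eR : ι → ℝ) (heR : ∀ i, 0 < eR i)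
    (T : ∀ i, Finset (PBond (F.P Kt) (k i)))
    (lo hi : ι → Fin (F.P Kt).d → ℤ) (n : ι → ℕ) (hn : ∀ i κ, hi i κ ≤ lo i κ + n i) (hN : ∀ i, n i + 2 < (F.P Kt).sitesPerDir (k i))
    (hbox : ∀ i, pts (k i) (Λ i) = (castSite '' Set.Icc (lo i) (hi i) : Set (Site (F.P Kt) (k i))))
    (hZ : ∀ i, (boxPlaqs (lo i - 1) (hi i + 1) : Set (Plaq (F.P Kt) (k i))) ⊆ plaqsInside (pts (k i) (Z i)))
    (hTG0 : ∀ i, T i = (box (fun κ => (hi i κ - lo i κ + 1).toNat) (lo i)).image fun x =>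
      (⟨castSite (x - unitVec ⟨0, h0⟩), ⟨0, h0⟩⟩ : PBond (F.P Kt) (k i)))
    (hN5 : ∀ i κ, ((hi i κ - lo i κ + 1).toNat : ℤ) + 5 < (F.P Kt).sitesPerDir (k i))
    (K : ι → ℕ) (hK1 : ∀ i, 1 ≤ K i) (hKn : ∀ i κ, (hi i κ - lo i κ + 1).toNat ≤ K i)
    (ext : ∀ i, GaugeField (F.P Kt) (k i) SU2 → GaugeField (F.P Kt) (k i) SU2)
    (hext : ∀ i Vk, ext i Vk = extend (pts (k i) (Λ i)) (shellGauge Vk (lo i) (hi i)) Vk)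
    (hlohi : ∀ i, lo i ≤ hi i)
    -- the REGION parallelepipeds of the normalisation and the datum tolerances
    (LO HI : ι → Fin (F.P Kt).d → ℤ) (hLO : ∀ i, LO i ≤ lo i - 1) (hHI : ∀ i, hi i + 1 ≤ HI i) (n' : ι → ℕ) (hn' : ∀ i κ, HI i κ ≤ LO i κ + n' i)
    (hn'N : ∀ i, n' i < (F.P Kt).sitesPerDir (k i)) (hR : ∀ i, (boxPlaqs (LO i) (HI i) : Set (Plaq (F.P Kt) (k i))) ⊆ plaqsInside (pts (k i) (Z i)))
    (ρn : ι → ℝ)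
    (hρn : ∀ i, (((F.P Kt).d : ℝ) * n' i + 1) * ((((F.P Kt).d - 1 : ℕ) : ℝ) * n' i * ((12 * (F.P Kt).d * (n i + 2) ^ 2 + 1) * eR i)
      + 3 * (F.P Kt).d * (n i + 2) ^ 2 * eR i) ≤ ρn i)
    {γ bx : ℝ} (hγ : 0 < γ) (hbx : 0 ≤ bx)
    (hbxM : ∀ i, 12 * ((F.P Kt).d : ℝ) * ((n i : ℝ) + 2) ^ 2 ≤ bx * (M i) ^ 2)
    {𝓐₀ : ι → ℝ} (hM : ∀ i, 1 ≤ (M i))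
    {γ₀ : ℝ} (hγ₀ : 0 ≤ γ₀)
    -- (J0′) IN THE COMPACTNESS ROUTE'S SHAPE: for every compact set of base fields inside the closed guard, ONE radius
    (hMinC : ∀ i (K : Set (GaugeField (F.P Kt) (k i) SU2)), IsCompact K →
      (∀ Vk ∈ K, ∀ p ∈ plaqsInside (pts (k i) (Z i ∩ (Λ i)ᶜ)), dist1 (GaugeField.plaqHol Vk p) ≤ eR i) →
      ∃ R : ℝ, 0 < R ∧ ∀ Vk ∈ K,
      ∃ Ũ : VecField (F.P Kt) (k i) (EuclideanSpace ℂ (Fin 3)) × VecField (F.P Kt) (k i) (EuclideanSpace ℂ (Fin 3)) →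
          PBond (F.P Kt) 0 → Matrix (Fin 2) (Fin 2) ℂ,
        (∀ b a c, DifferentiableOn ℂ (fun z => Ũ z b a c) (ball 0 R)) ∧
        (∀ z ∈ ball (0 : VecField (F.P Kt) (k i) (EuclideanSpace ℂ (Fin 3)) × VecField (F.P Kt) (k i) (EuclideanSpace ℂ (Fin 3))) R,
          ∀ b a c, ‖Ũ z b a c‖ ≤ 𝓐₀ i) ∧
        ∀ p B' : VecField (F.P Kt) (k i) E3, ‖p‖ < R → ‖B'‖ < R → ∃ U' : GaugeField (F.P Kt) 0 SU2,
          (∀ b, Ũ (cplxVec p, cplxVec B') b = ((U' b : SU2) : Matrix (Fin 2) (Fin 2) ℂ)) ∧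
            IsMinimizer (Node00.avOfRecord F 2 Kt) (Node00.regMSCoPOfRecord F 2 ν Kt (k i) (maxDomT ν.M₁ (Z i))) (Bj ν.M₁ (Z i) (k i))
              (avgFamily (Node00.avOfRecord F 2 Kt) (qsstarGIter0 (k i) (expMul su2Chart B' (ext i (expMul su2Chart p Vk))))) U')
    -- (N) THE NEAR-FLAT LETTER PACKAGE per instance, asked ONLY at the guarded base fields whose extended datum is `ρn i`-near `1` on the region box (replaces (L2))
    {δc μc ρc δ₂c Kc τc : ι → ℝ} (hδc0 : ∀ i, 0 ≤ δc i) (hμc0 : ∀ i, 0 ≤ μc i) (hρc0 : ∀ i, 0 ≤ ρc i) (hδ₂c0 : ∀ i, 0 ≤ δ₂c i)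
    (hNFn : ∀ i (Vk : GaugeField (F.P Kt) (k i) SU2), PlaqSmallOn (plaqsInside (pts (k i) (Z i ∩ (Λ i)ᶜ))) (eR i) Vk →
      (∀ b ∈ (boxBonds (LO i) (HI i) : Set (PBond (F.P Kt) (k i))), dist1 (ext i Vk b) ≤ ρn i) →
      ∃ (U₀ : GaugeField (F.P Kt) 0 SU2) (Xf : GaugeSlice (pts (k i) (Λ i)) (T i) E3 → PBond (F.P Kt) 0 → lieSU (Fin 2)),
        (∀ p : Plaq (F.P Kt) 0, ((⟨p.src, p.μ⟩ : PBond (F.P Kt) 0) ∈ {b : PBond (F.P Kt) 0 | b.src ∈ maxDomT ν.M₁ (Z i) 1} ∨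
            (⟨p.src.shift p.μ, p.ν⟩ : PBond (F.P Kt) 0) ∈ {b : PBond (F.P Kt) 0 | b.src ∈ maxDomT ν.M₁ (Z i) 1} ∨
            (⟨p.src.shift p.ν, p.μ⟩ : PBond (F.P Kt) 0) ∈ {b : PBond (F.P Kt) 0 | b.src ∈ maxDomT ν.M₁ (Z i) 1} ∨
            (⟨p.src, p.ν⟩ : PBond (F.P Kt) 0) ∈ {b : PBond (F.P Kt) 0 | b.src ∈ maxDomT ν.M₁ (Z i) 1}) →
          ‖((U₀ ⟨p.src, p.μ⟩ : SU2) : Matrix (Fin 2) (Fin 2) ℂ) - 1‖ ≤ δc i ∧ ‖((U₀ ⟨p.src.shift p.μ, p.ν⟩ : SU2) : Matrix (Fin 2) (Fin 2) ℂ) - 1‖ ≤ δc i ∧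
            ‖((U₀ ⟨p.src.shift p.ν, p.μ⟩ : SU2) : Matrix (Fin 2) (Fin 2) ℂ) - 1‖ ≤ δc i ∧ ‖((U₀ ⟨p.src, p.ν⟩ : SU2) : Matrix (Fin 2) (Fin 2) ℂ) - 1‖ ≤ δc i) ∧
        Xf 0 = 0 ∧ ContDiffAt ℝ 2 Xf 0 ∧
        (∀ᶠ Y in 𝓝 (0 : GaugeSlice (pts (k i) (Λ i)) (T i) E3),
          IsMinimizer (Node00.avOfRecord F 2 Kt) (Node00.regMSCoPOfRecord F 2 ν Kt (k i) (maxDomT ν.M₁ (Z i))) (Bj ν.M₁ (Z i) (k i))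
            (avgFamily (Node00.avOfRecord F 2 Kt) (qsstarGIter0 (k i) (expMul su2Chart (ιA (pts (k i) (Λ i)) (T i) Y) (ext i Vk)))) (expChart U₀ (Xf Y))) ∧
        ∃ (Ψ₂ : (PBond (F.P Kt) 0 → lieSU (Fin 2)) →L[ℝ] (PBond (F.P Kt) 0 → lieSU (Fin 2)) →L[ℝ] (Fin (constrCard (Bj ν.M₁ (Z i) (k i)) (k i)) → lieSU (Fin 2)))
          (lam : (Fin (constrCard (Bj ν.M₁ (Z i) (k i)) (k i)) → lieSU (Fin 2)) →L[ℝ] ℝ)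
          (p : Seminorm ℝ (PBond (F.P Kt) 0 → lieSU (Fin 2))) (q : (Fin (constrCard (Bj ν.M₁ (Z i) (k i)) (k i)) → lieSU (Fin 2)) → ℝ)
          (Lf : (PBond (F.P Kt) 0 → lieSU (Fin 2)) →L[ℝ] (Fin (constrCard (Bj ν.M₁ (Z i) (k i)) (k i)) → lieSU (Fin 2)))
          (Rf : (Fin (constrCard (Bj ν.M₁ (Z i) (k i)) (k i)) → lieSU (Fin 2)) → PBond (F.P Kt) 0 → lieSU (Fin 2)),
          HasFDerivAt (fun Y => fderiv ℝ (msChart F 2 Kt (k i) (Bj ν.M₁ (Z i) (k i)) (avgFamily (Node00.avOfRecord F 2 Kt) (qsstarGIter0 (k i) (ext i Vk))) U₀) Y) Ψ₂ 0 ∧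
          (∀ᶠ Y in 𝓝 (0 : PBond (F.P Kt) 0 → lieSU (Fin 2)),
            DifferentiableAt ℝ (msChart F 2 Kt (k i) (Bj ν.M₁ (Z i) (k i)) (avgFamily (Node00.avOfRecord F 2 Kt) (qsstarGIter0 (k i) (ext i Vk))) U₀) Y) ∧
          fderiv ℝ (fun Y : PBond (F.P Kt) 0 → lieSU (Fin 2) => wilsonAction4 (expChart U₀ Y)) 0 =
            lam.comp (fderiv ℝ (msChart F 2 Kt (k i) (Bj ν.M₁ (Z i) (k i)) (avgFamily (Node00.avOfRecord F 2 Kt) (qsstarGIter0 (k i) (ext i Vk))) U₀) 0) ∧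
          (∀ Y : PBond (F.P Kt) 0 → lieSU (Fin 2), ∑ b, ‖(Y b : Matrix (Fin 2) (Fin 2) ℂ)‖ ^ 2 ≤ p Y ^ 2) ∧
          (∀ v, Lf (Rf v) = v) ∧ (∀ v, p (Rf v) ≤ ρc i * q v) ∧
          ∀ X : GaugeSlice (pts (k i) (Λ i)) (T i) E3,
            q (fderiv ℝ (msChart F 2 Kt (k i) (Bj ν.M₁ (Z i) (k i)) (avgFamily (Node00.avOfRecord F 2 Kt) (qsstarGIter0 (k i) (ext i Vk))) U₀) 0 (fderiv ℝ Xf 0 X)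
                - Lf (fderiv ℝ Xf 0 X)) ≤ δ₂c i * p (fderiv ℝ Xf 0 X) ∧
            lam (Ψ₂ (fderiv ℝ Xf 0 X) (fderiv ℝ Xf 0 X)) ≤ μc i * p (fderiv ℝ Xf 0 X) ^ 2 ∧
            p (fderiv ℝ Xf 0 X) ≤ Kc i * ‖X‖ ∧
            ∃ m : ℝ, (∀ w', Lf w' = fderiv ℝ (msChart F 2 Kt (k i) (Bj ν.M₁ (Z i) (k i)) (avgFamily (Node00.avOfRecord F 2 Kt) (qsstarGIter0 (k i) (ext i Vk))) U₀) 0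
                  (fderiv ℝ Xf 0 X) →
                m ≤ fderiv ℝ (fun Y => fderiv ℝ (fun Y : PBond (F.P Kt) 0 → lieSU (Fin 2) => wilsonAction4 (expChart (1 : GaugeField (F.P Kt) 0 SU2) Y)) Y) 0 w' w') ∧
              γ₀ * (∑ z ∈ box (fun κ => (hi i κ - lo i κ + 1).toNat + 3) (fun κ => lo i κ - 2), ∑ μ : Fin (F.P Kt).d, ∑ a : Fin 3,
                  curl (fun b => ιA (pts (k i) (Λ i)) (T i) X (⟨castSite b.1, b.2⟩ : PBond (F.P Kt) (k i)) a) z ⟨0, h0⟩ μ ^ 2) - τc i * ‖X‖ ^ 2 ≤ m)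
    -- numerics: the assembled `Cerr i` (with the twist defect `τc i`) is small, and the positivity constant fits
    (hsm : ∀ i, (32 * (((F.P Kt).d : ℝ) - 1) * δc i + μc i + 16 * (((F.P Kt).d : ℝ) - 1) * (ρc i * δ₂c i) * (2 + ρc i * δ₂c i)) * Kc i ^ 2 + τc i
      ≤ γ₀ / (2 * (3 * (K i : ℝ) ^ 2 + 2 * (K i : ℝ) ^ 4)))
    (hγle : ∀ i, γ / (M i) ^ 5 ≤ γ₀ / (2 * (3 * (K i : ℝ) ^ 2 + 2 * (K i : ℝ) ^ 4)))
    (hfar : ∀ i (b : PBond (F.P Kt) 0), b.src ∉ maxDomT ν.M₁ (Z i) 1 →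
      (⟨blockIter (k i) b.src, b.dir⟩ : PBond (F.P Kt) (k i)) ∉ bondsOf (pts (k i) (Λ i)))
    (hZblk : ∀ i, IsBlockUnion (k i) (Z i))
    (hM2 : 2 ≤ ν.M₁) (hdiv : ∀ i, side (F.P Kt).L ν.M₁ (k i) ∣ (F.P Kt).sitesPerDir 0)
    {cE B₃ a₀ a₁' cA : ℝ} (hcE0 : 0 ≤ cE) (hcE : ∀ i, 12 * ((F.P Kt).d : ℝ) * ((n i : ℝ) + 2) ^ 2 ≤ cE) (hB₃ : 0 ≤ B₃)
    (heRa : ∀ i, (cE + 1) * eR i ≤ a₁' ∧ B₃ * ((cE + 1) * eR i) ≤ ν.εreg) (ha₀ : ν.εreg ≤ a₀)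
    (hcA : 1 / 2 * (B₃ * (cE + 1) * (F.P Kt).eta 1 ^ 2) ^ 2 * (Fintype.card (Plaq (F.P Kt) 0) : ℝ) ≤ cA)
    (h15T : ∀ (k' : ℕ), k' ≤ (F.P Kt).m + (F.P Kt).K → side (F.P Kt).L ν.M₁ k' ∣ (F.P Kt).sitesPerDir 0 →
      ∀ (s : B14.Eq218Concrete.Seq (fun n : ℕ => Node00.unionsOfCubes (F.P Kt) (side (F.P Kt).L ν.M₁ n)) k'),
      Node00.Sect2.SeqSeparated ν.M₁ s → 0 < ν.M₁ →
      ∀ (ε₀ : ℝ) (δ : ℕ → ℝ), (∀ j, j ≤ k' → 0 < δ j ∧ δ j ≤ a₁' ∧ B₃ * δ j ≤ ε₀) → (∀ j, j < k' → δ j ≤ 2 * δ (j + 1)) →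
      (∀ j, j < k' → δ (j + 1) ≤ 2 * δ j) → ε₀ ≤ a₀ →
      ∀ W : MSField (F.P Kt) SU2,
        Node00.Sect2.DataSmall7PTop (Node00.avOfRecord F 2 Kt) s.Ω (Node00.suppDomOfRecord F ν Kt s.Ω) k' δ W →
        ∀ U₀ : GaugeField (F.P Kt) 0 SU2, IsMinimizer (Node00.avOfRecord F 2 Kt)
            {U | (∀ j, j ≤ k' → PlaqSmallOn (Node00.Sect2.omegaPlaqsTop s.Ω (Node00.suppDomOfRecord F ν Kt s.Ω) j)
                (ε₀ * (F.P Kt).eta j ^ 2) U) ∧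
              Node00.Sect2.CoDivClassOnTop s.Ω (Node00.suppDomOfRecord F ν Kt s.Ω) k' ε₀ U}
            (genSet s.Ω k') W U₀ →
          (∀ j, j ≤ k' → PlaqSmallOn (Node00.Sect2.omegaPlaqsTop s.Ω (Node00.suppDomOfRecord F ν Kt s.Ω) j)
              (B₃ * δ j * (F.P Kt).eta j ^ 2) U₀) ∧
            ∀ j, j ≤ k' → Node00.Sect2.CoDivSmallOn (Node00.Sect2.omegaBondsTop s.Ω (Node00.suppDomOfRecord F ν Kt s.Ω) j)
              (B₃ * δ j * (F.P Kt).eta j ^ 3) U₀)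
    : ∃ R : ι → ℝ, (∀ i, 0 < R i) ∧ ∃ a₁ : ι → ℝ, (∀ i, 0 < a₁ i) ∧
      B15.Prop1Printed (lfVarOn su2Chart fun i =>
        InstOn.std (Node00.bgMSCoPOfRecord F 2 ν Kt (k i) (maxDomT ν.M₁ (Z i))) ν.M₁ (Z i) (Λ i) (k i) (M i) (a₁ i)
          (anExt (pts (k i) (Λ i)) (T i)
            (fun177std (Node00.bgMSCoPOfRecord F 2 ν Kt (k i) (maxDomT ν.M₁ (Z i))) ν.M₁ (Z i) (k i)) (ext i)
            (min (1 / 2) (min (R i / 8) (γ / (M i) ^ 5 * (R i / 2) ^ 2 /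
              (48 * (4 * ((Fintype.card (Plaq (F.P Kt) 0) : ℝ) * (1 + 8 * 𝓐₀ i ^ 4)) / R i + 1))))))) :=
  B15Prop1CoerciveEdition.exists_domain_prop1Printed_lfVarOn_std_su2_box_intrinsic_analytic_atZSeqCoPRecord_ofThm1TorusClass_ofMinimiserFamilyCompact_ofCoercive
    ν Kt hd3 h0 (hdec := inferInstance) (Subsingleton.elim _ _)
    Z Λ k M hk0 hk eR heR T lo hi n hn hN hbox hZ hTG0 hN5 ext hext hlohi hγ hbx hbxM hM hMinC
    (hcoer_of_nearFlatLettersNormalised_sub_loc ν Kt hd3 h0 Z Λ k M hk0 hk eR heR T lo hi n hn hbox hZ hTG0 hN5 K hK1 hKn ext hext hlohi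
      LO HI hLO hHI n' hn' hn'N hR ρn hρn hγ₀ hδc0 hμc0 hρc0 hδ₂c0 hNFn hsm hγle hfar)
    hfar hZblk hM2 hdiv hcE0 hcE hB₃ heRa ha₀ hcA h15T

end Endpoint

/-! ## §5  (v1.1) The general-region editions: the normaliser displayed as a letter on an arbitrary bond set (LOCATED-GEOM made a hypothesis) -/

section GeneralRegion

variable {F : T4Family}

/-- ★★★ **THE GENERAL-REGION EDITION OF §3: THE (1.9) LETTER `hcoer` FROM THE PACKAGE (N) AT THE GAUGE-NORMALISABLE BASE FIELDS, THE NORMALISER DISPLAYED.**  As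
`hcoer_of_nearFlatLettersNormalised_sub_loc`, but the region parallelepiped and dag-n12-w6's box normaliser are replaced by the displayed letter `hgauge`: per instance a set of
`k`-bonds `𝒞 i` and a tolerance `ρn i` such that every base field of the (1.74) guard admits a gauge transformation `u` of `T^{(k)}` with `u = 1` on `Λ_i^{(k)}`, `u(c₀) = 1` at the shell
corner, and `Ṽ(V_k)^u` `ρn i`-near `1` on `𝒞 i`; the package `hNFn` is asked only at guarded `V_k` with `Ṽ(V_k)` `ρn i`-near `1` on `𝒞 i`.  (For `𝒞 i = boxBonds (LO i) (HI i)` inside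
`Z_i^{(k)}`, `hgauge` is dag-n12-w6's `exists_gauge_normalising_extend_shellGauged`; a normaliser on a general component of print's `Z` plugs in here — LOCATED-GEOM made a letter.)
Proof: §2's `sliceCoercive_of_gaugeNormalisable` at the background of record with `hnorm` supplied by §1. [cite: Balaban1989LargeFieldI, (1.74) p.192, p.193, (1.77) and the sentence after it, Prop. 1 p.194;
Balaban1989LargeFieldII, p.357, (1.7)–(1.9) p.358, (1.12)–(1.13) p.359; Balaban1985Variational, (47) p.285, (81) p.290, Prop. 9 (190) p.309; Balaban1988Convergent, (2.2) p.255, (2.12)–(2.13) pp.256–257] -/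
theorem hcoer_of_nearFlatLettersGaugeNormalisable_sub_loc
    (ν : Node00.Stage7Numerics) (Kt : ℕ) (hd3 : 3 ≤ (F.P Kt).d) (h0 : 0 < (F.P Kt).d) {ι : Type}
    (Z Λ : ι → Set (Site (F.P Kt) 0)) (k : ι → ℕ) (M : ι → ℝ) (hk0 : ∀ i, 0 < k i) (hk : ∀ i, k i ≤ (F.P Kt).m + (F.P Kt).K)
    (eR : ι → ℝ)
    (T : ∀ i, Finset (PBond (F.P Kt) (k i)))
    (lo hi : ι → Fin (F.P Kt).d → ℤ)
    (hbox : ∀ i, pts (k i) (Λ i) = (castSite '' Set.Icc (lo i) (hi i) : Set (Site (F.P Kt) (k i))))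
    (hTG0 : ∀ i, T i = (box (fun κ => (hi i κ - lo i κ + 1).toNat) (lo i)).image fun x =>
      (⟨castSite (x - unitVec ⟨0, h0⟩), ⟨0, h0⟩⟩ : PBond (F.P Kt) (k i)))
    (hN5 : ∀ i κ, ((hi i κ - lo i κ + 1).toNat : ℤ) + 5 < (F.P Kt).sitesPerDir (k i))
    (K : ι → ℕ) (hK1 : ∀ i, 1 ≤ K i) (hKn : ∀ i κ, (hi i κ - lo i κ + 1).toNat ≤ K i)
    (ext : ∀ i, GaugeField (F.P Kt) (k i) SU2 → GaugeField (F.P Kt) (k i) SU2)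
    (hext : ∀ i Vk, ext i Vk = extend (pts (k i) (Λ i)) (shellGauge Vk (lo i) (hi i)) Vk)
    -- the NORMALISATION, displayed: per instance a set of `k`-bonds `𝒞 i`, a tolerance `ρn i`, and for every guarded base field a gauge of `T^{(k)}` fixing `Λ^{(k)}`
    -- and the shell corner under which the extended datum is `ρn i`-near `1` on `𝒞 i`
    (𝒞 : ∀ i, Set (PBond (F.P Kt) (k i))) (ρn : ι → ℝ)
    (hgauge : ∀ i (Vk : GaugeField (F.P Kt) (k i) SU2), PlaqSmallOn (plaqsInside (pts (k i) (Z i ∩ (Λ i)ᶜ))) (eR i) Vk →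
      ∃ u : GaugeTransf (F.P Kt) (k i) SU2, (∀ s ∈ pts (k i) (Λ i), u s = 1) ∧ u (castSite (lo i - 1)) = 1 ∧
        ∀ b ∈ 𝒞 i, dist1 (gaugeAct u (ext i Vk) b) ≤ ρn i)
    {γ : ℝ} {γ₀ : ℝ} (hγ₀ : 0 ≤ γ₀)
    -- (N) THE NEAR-FLAT LETTER PACKAGE per instance, asked ONLY at the guarded base fields whose extended datum is `ρn i`-near `1` on `𝒞 i`
    {δc μc ρc δ₂c Kc τc : ι → ℝ} (hδc0 : ∀ i, 0 ≤ δc i) (hμc0 : ∀ i, 0 ≤ μc i) (hρc0 : ∀ i, 0 ≤ ρc i) (hδ₂c0 : ∀ i, 0 ≤ δ₂c i)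
    (hNFn : ∀ i (Vk : GaugeField (F.P Kt) (k i) SU2), PlaqSmallOn (plaqsInside (pts (k i) (Z i ∩ (Λ i)ᶜ))) (eR i) Vk →
      (∀ b ∈ 𝒞 i, dist1 (ext i Vk b) ≤ ρn i) →
      ∃ (U₀ : GaugeField (F.P Kt) 0 SU2) (Xf : GaugeSlice (pts (k i) (Λ i)) (T i) E3 → PBond (F.P Kt) 0 → lieSU (Fin 2)),
        (∀ p : Plaq (F.P Kt) 0, ((⟨p.src, p.μ⟩ : PBond (F.P Kt) 0) ∈ {b : PBond (F.P Kt) 0 | b.src ∈ maxDomT ν.M₁ (Z i) 1} ∨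
            (⟨p.src.shift p.μ, p.ν⟩ : PBond (F.P Kt) 0) ∈ {b : PBond (F.P Kt) 0 | b.src ∈ maxDomT ν.M₁ (Z i) 1} ∨
            (⟨p.src.shift p.ν, p.μ⟩ : PBond (F.P Kt) 0) ∈ {b : PBond (F.P Kt) 0 | b.src ∈ maxDomT ν.M₁ (Z i) 1} ∨
            (⟨p.src, p.ν⟩ : PBond (F.P Kt) 0) ∈ {b : PBond (F.P Kt) 0 | b.src ∈ maxDomT ν.M₁ (Z i) 1}) →
          ‖((U₀ ⟨p.src, p.μ⟩ : SU2) : Matrix (Fin 2) (Fin 2) ℂ) - 1‖ ≤ δc i ∧ ‖((U₀ ⟨p.src.shift p.μ, p.ν⟩ : SU2) : Matrix (Fin 2) (Fin 2) ℂ) - 1‖ ≤ δc i ∧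
            ‖((U₀ ⟨p.src.shift p.ν, p.μ⟩ : SU2) : Matrix (Fin 2) (Fin 2) ℂ) - 1‖ ≤ δc i ∧ ‖((U₀ ⟨p.src, p.ν⟩ : SU2) : Matrix (Fin 2) (Fin 2) ℂ) - 1‖ ≤ δc i) ∧
        Xf 0 = 0 ∧ ContDiffAt ℝ 2 Xf 0 ∧
        (∀ᶠ Y in 𝓝 (0 : GaugeSlice (pts (k i) (Λ i)) (T i) E3),
          IsMinimizer (Node00.avOfRecord F 2 Kt) (Node00.regMSCoPOfRecord F 2 ν Kt (k i) (maxDomT ν.M₁ (Z i))) (Bj ν.M₁ (Z i) (k i))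
            (avgFamily (Node00.avOfRecord F 2 Kt) (qsstarGIter0 (k i) (expMul su2Chart (ιA (pts (k i) (Λ i)) (T i) Y) (ext i Vk)))) (expChart U₀ (Xf Y))) ∧
        ∃ (Ψ₂ : (PBond (F.P Kt) 0 → lieSU (Fin 2)) →L[ℝ] (PBond (F.P Kt) 0 → lieSU (Fin 2)) →L[ℝ] (Fin (constrCard (Bj ν.M₁ (Z i) (k i)) (k i)) → lieSU (Fin 2)))
          (lam : (Fin (constrCard (Bj ν.M₁ (Z i) (k i)) (k i)) → lieSU (Fin 2)) →L[ℝ] ℝ)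
          (p : Seminorm ℝ (PBond (F.P Kt) 0 → lieSU (Fin 2))) (q : (Fin (constrCard (Bj ν.M₁ (Z i) (k i)) (k i)) → lieSU (Fin 2)) → ℝ)
          (Lf : (PBond (F.P Kt) 0 → lieSU (Fin 2)) →L[ℝ] (Fin (constrCard (Bj ν.M₁ (Z i) (k i)) (k i)) → lieSU (Fin 2)))
          (Rf : (Fin (constrCard (Bj ν.M₁ (Z i) (k i)) (k i)) → lieSU (Fin 2)) → PBond (F.P Kt) 0 → lieSU (Fin 2)),
          HasFDerivAt (fun Y => fderiv ℝ (msChart F 2 Kt (k i) (Bj ν.M₁ (Z i) (k i)) (avgFamily (Node00.avOfRecord F 2 Kt) (qsstarGIter0 (k i) (ext i Vk))) U₀) Y) Ψ₂ 0 ∧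
          (∀ᶠ Y in 𝓝 (0 : PBond (F.P Kt) 0 → lieSU (Fin 2)),
            DifferentiableAt ℝ (msChart F 2 Kt (k i) (Bj ν.M₁ (Z i) (k i)) (avgFamily (Node00.avOfRecord F 2 Kt) (qsstarGIter0 (k i) (ext i Vk))) U₀) Y) ∧
          fderiv ℝ (fun Y : PBond (F.P Kt) 0 → lieSU (Fin 2) => wilsonAction4 (expChart U₀ Y)) 0 =
            lam.comp (fderiv ℝ (msChart F 2 Kt (k i) (Bj ν.M₁ (Z i) (k i)) (avgFamily (Node00.avOfRecord F 2 Kt) (qsstarGIter0 (k i) (ext i Vk))) U₀) 0) ∧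
          (∀ Y : PBond (F.P Kt) 0 → lieSU (Fin 2), ∑ b, ‖(Y b : Matrix (Fin 2) (Fin 2) ℂ)‖ ^ 2 ≤ p Y ^ 2) ∧
          (∀ v, Lf (Rf v) = v) ∧ (∀ v, p (Rf v) ≤ ρc i * q v) ∧
          ∀ X : GaugeSlice (pts (k i) (Λ i)) (T i) E3,
            q (fderiv ℝ (msChart F 2 Kt (k i) (Bj ν.M₁ (Z i) (k i)) (avgFamily (Node00.avOfRecord F 2 Kt) (qsstarGIter0 (k i) (ext i Vk))) U₀) 0 (fderiv ℝ Xf 0 X)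
                - Lf (fderiv ℝ Xf 0 X)) ≤ δ₂c i * p (fderiv ℝ Xf 0 X) ∧
            lam (Ψ₂ (fderiv ℝ Xf 0 X) (fderiv ℝ Xf 0 X)) ≤ μc i * p (fderiv ℝ Xf 0 X) ^ 2 ∧
            p (fderiv ℝ Xf 0 X) ≤ Kc i * ‖X‖ ∧
            ∃ m : ℝ, (∀ w', Lf w' = fderiv ℝ (msChart F 2 Kt (k i) (Bj ν.M₁ (Z i) (k i)) (avgFamily (Node00.avOfRecord F 2 Kt) (qsstarGIter0 (k i) (ext i Vk))) U₀) 0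
                  (fderiv ℝ Xf 0 X) →
                m ≤ fderiv ℝ (fun Y => fderiv ℝ (fun Y : PBond (F.P Kt) 0 → lieSU (Fin 2) => wilsonAction4 (expChart (1 : GaugeField (F.P Kt) 0 SU2) Y)) Y) 0 w' w') ∧
              γ₀ * (∑ z ∈ box (fun κ => (hi i κ - lo i κ + 1).toNat + 3) (fun κ => lo i κ - 2), ∑ μ : Fin (F.P Kt).d, ∑ a : Fin 3,
                  curl (fun b => ιA (pts (k i) (Λ i)) (T i) X (⟨castSite b.1, b.2⟩ : PBond (F.P Kt) (k i)) a) z ⟨0, h0⟩ μ ^ 2) - τc i * ‖X‖ ^ 2 ≤ m)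
    -- numerics: the assembled `Cerr i` (with the twist defect `τc i`) is small, and the positivity constant fits
    (hsm : ∀ i, (32 * (((F.P Kt).d : ℝ) - 1) * δc i + μc i + 16 * (((F.P Kt).d : ℝ) - 1) * (ρc i * δ₂c i) * (2 + ρc i * δ₂c i)) * Kc i ^ 2 + τc i
      ≤ γ₀ / (2 * (3 * (K i : ℝ) ^ 2 + 2 * (K i : ℝ) ^ 4)))
    (hγle : ∀ i, γ / (M i) ^ 5 ≤ γ₀ / (2 * (3 * (K i : ℝ) ^ 2 + 2 * (K i : ℝ) ^ 4)))
    (hfar : ∀ i (b : PBond (F.P Kt) 0), b.src ∉ maxDomT ν.M₁ (Z i) 1 →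
      (⟨blockIter (k i) b.src, b.dir⟩ : PBond (F.P Kt) (k i)) ∉ bondsOf (pts (k i) (Λ i)))
    : ∀ i (Vk : GaugeField (F.P Kt) (k i) SU2), PlaqSmallOn (plaqsInside (pts (k i) (Z i ∩ (Λ i)ᶜ))) (eR i) Vk →
      ∀ X : GaugeSlice (pts (k i) (Λ i)) (T i) E3,
        γ / (M i) ^ 5 * ‖X‖ ^ 2 ≤ ⟪X, (fderiv ℝ (rGrad (pts (k i) (Λ i)) (T i)
          (sliceFn (pts (k i) (Λ i)) (T i)
            (fun177std (Node00.bgMSCoPOfRecord F 2 ν Kt (k i) (maxDomT ν.M₁ (Z i))) ν.M₁ (Z i) (k i)) (ext i Vk))) 0) X⟫_ℝ := by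
  intro i Vk hV X
  -- the box is non-wrapping with margin (from `hN5`)
  have hN : ∀ κ, hi i κ - lo i κ + 3 < ((F.P Kt).sitesPerDir (k i) : ℤ) := fun κ => by
    have h5 := hN5 i κ
    have : hi i κ - lo i κ + 1 ≤ ((hi i κ - lo i κ + 1).toNat : ℤ) := Int.self_le_toNat _
    linarith
  refine sliceCoercive_of_gaugeNormalisable hN (hbox i) (ext i) (hext i)
    (fun u W => fun177std_bgMSCoPOfRecord_gaugeAct ν Kt (k i) (maxDomT ν.M₁ (Z i)) ν.M₁ (Z i) (hk i) u W) (T i) (γ / (M i) ^ 5)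
    (𝒞 i) (ρn i) (hgauge i) (fun V hV' hnV X' => ?_) Vk hV X
  -- (1.9) at a normalised base field from the package (N) there (§1)
  obtain ⟨U₀, Xf, hU, hX₀, hXc, hmin, Ψ₂, lam, p, q, Lf, Rf, hΨ₂, hΨd, hlam, hp, hRf, hρ, hX⟩ := hNFn i V hV' hnV
  exact sliceCoercive_of_nearFlatLetters_sub_loc ν Kt hd3 h0 (hk0 i) (hk i) (Z i) (Λ i) (T i) (hbox i) (hTG0 i) (hN5 i) (hK1 i) (hKn i)
    (ext i) V (hfar i) hγ₀ (hδc0 i) (hμc0 i) (hρc0 i) (hδ₂c0 i) U₀ hU Xf hX₀ hXc hmin hΨ₂ hΨd hlam p hp q Lf hRf hρ hX (hsm i) (hγle i) X'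

/-- ★★★ **PROPOSITION 1 [IV] AT PRINT'S (1.74) OBJECT — COERCIVE ROAD, GENERAL-REGION EDITION**: §4's endpoint with the region parallelepiped replaced by the displayed normaliser letter
`hgauge` on an arbitrary bond set `𝒞 i` (see `hcoer_of_nearFlatLettersGaugeNormalisable_sub_loc`); everything else binder for binder.  dag-n12-w5's coercive record endpoint fed by §5's
family letter.  Nothing of Bałaban's is asserted. [cite: Balaban1989LargeFieldI, (1.74) p.192, p.193, (1.77) and the sentence after it, Prop. 1 (1.77)–(1.78) p.194 (incl. the last clause), (1.79) p.195;
Balaban1989LargeFieldII, p.357, (1.7)–(1.9) p.358, (1.12)–(1.13) p.359, (1.19) p.360; Balaban1985Variational, (7) p.278, Thm 1 (8) p.279, (47) p.285, (81) p.290, Prop. 9 (190) p.309;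
Balaban1988Convergent, (2.2) p.255, (2.12)–(2.14) pp.256–257] -/
theorem exists_domain_prop1Printed_lfVarOn_std_su2_box_intrinsic_analytic_atZSeqCoPRecord_ofThm1TorusClass_ofMinimiserFamilyCompact_ofNearFlatLettersGaugeNormalisable_sub_loc_ofCoercive
    (ν : Node00.Stage7Numerics) (Kt : ℕ) (hd3 : 3 ≤ (F.P Kt).d) (h0 : 0 < (F.P Kt).d) {ι : Type} [Finite ι]
    (Z Λ : ι → Set (Site (F.P Kt) 0)) (k : ι → ℕ) (M : ι → ℝ) (hk0 : ∀ i, 0 < k i) (hk : ∀ i, k i ≤ (F.P Kt).m + (F.P Kt).K)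
    (eR : ι → ℝ) (heR : ∀ i, 0 < eR i)
    (T : ∀ i, Finset (PBond (F.P Kt) (k i)))
    (lo hi : ι → Fin (F.P Kt).d → ℤ) (n : ι → ℕ) (hn : ∀ i κ, hi i κ ≤ lo i κ + n i) (hN : ∀ i, n i + 2 < (F.P Kt).sitesPerDir (k i))
    (hbox : ∀ i, pts (k i) (Λ i) = (castSite '' Set.Icc (lo i) (hi i) : Set (Site (F.P Kt) (k i))))
    (hZ : ∀ i, (boxPlaqs (lo i - 1) (hi i + 1) : Set (Plaq (F.P Kt) (k i))) ⊆ plaqsInside (pts (k i) (Z i)))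
    (hTG0 : ∀ i, T i = (box (fun κ => (hi i κ - lo i κ + 1).toNat) (lo i)).image fun x =>
      (⟨castSite (x - unitVec ⟨0, h0⟩), ⟨0, h0⟩⟩ : PBond (F.P Kt) (k i)))
    (hN5 : ∀ i κ, ((hi i κ - lo i κ + 1).toNat : ℤ) + 5 < (F.P Kt).sitesPerDir (k i))
    (K : ι → ℕ) (hK1 : ∀ i, 1 ≤ K i) (hKn : ∀ i κ, (hi i κ - lo i κ + 1).toNat ≤ K i)
    (ext : ∀ i, GaugeField (F.P Kt) (k i) SU2 → GaugeField (F.P Kt) (k i) SU2)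
    (hext : ∀ i Vk, ext i Vk = extend (pts (k i) (Λ i)) (shellGauge Vk (lo i) (hi i)) Vk)
    (hlohi : ∀ i, lo i ≤ hi i)
    -- the NORMALISATION, displayed: per instance a set of `k`-bonds `𝒞 i`, a tolerance `ρn i`, and for every guarded base field a gauge of `T^{(k)}` fixing `Λ^{(k)}`
    -- and the shell corner under which the extended datum is `ρn i`-near `1` on `𝒞 i`
    (𝒞 : ∀ i, Set (PBond (F.P Kt) (k i))) (ρn : ι → ℝ)
    (hgauge : ∀ i (Vk : GaugeField (F.P Kt) (k i) SU2), PlaqSmallOn (plaqsInside (pts (k i) (Z i ∩ (Λ i)ᶜ))) (eR i) Vk →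
      ∃ u : GaugeTransf (F.P Kt) (k i) SU2, (∀ s ∈ pts (k i) (Λ i), u s = 1) ∧ u (castSite (lo i - 1)) = 1 ∧
        ∀ b ∈ 𝒞 i, dist1 (gaugeAct u (ext i Vk) b) ≤ ρn i)
    {γ bx : ℝ} (hγ : 0 < γ) (hbx : 0 ≤ bx)
    (hbxM : ∀ i, 12 * ((F.P Kt).d : ℝ) * ((n i : ℝ) + 2) ^ 2 ≤ bx * (M i) ^ 2)
    {𝓐₀ : ι → ℝ} (hM : ∀ i, 1 ≤ (M i))
    {γ₀ : ℝ} (hγ₀ : 0 ≤ γ₀)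
    -- (J0′) IN THE COMPACTNESS ROUTE'S SHAPE: for every compact set of base fields inside the closed guard, ONE radius
    (hMinC : ∀ i (K : Set (GaugeField (F.P Kt) (k i) SU2)), IsCompact K →
      (∀ Vk ∈ K, ∀ p ∈ plaqsInside (pts (k i) (Z i ∩ (Λ i)ᶜ)), dist1 (GaugeField.plaqHol Vk p) ≤ eR i) →
      ∃ R : ℝ, 0 < R ∧ ∀ Vk ∈ K,
      ∃ Ũ : VecField (F.P Kt) (k i) (EuclideanSpace ℂ (Fin 3)) × VecField (F.P Kt) (k i) (EuclideanSpace ℂ (Fin 3)) →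
          PBond (F.P Kt) 0 → Matrix (Fin 2) (Fin 2) ℂ,
        (∀ b a c, DifferentiableOn ℂ (fun z => Ũ z b a c) (ball 0 R)) ∧
        (∀ z ∈ ball (0 : VecField (F.P Kt) (k i) (EuclideanSpace ℂ (Fin 3)) × VecField (F.P Kt) (k i) (EuclideanSpace ℂ (Fin 3))) R,
          ∀ b a c, ‖Ũ z b a c‖ ≤ 𝓐₀ i) ∧
        ∀ p B' : VecField (F.P Kt) (k i) E3, ‖p‖ < R → ‖B'‖ < R → ∃ U' : GaugeField (F.P Kt) 0 SU2,
          (∀ b, Ũ (cplxVec p, cplxVec B') b = ((U' b : SU2) : Matrix (Fin 2) (Fin 2) ℂ)) ∧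
            IsMinimizer (Node00.avOfRecord F 2 Kt) (Node00.regMSCoPOfRecord F 2 ν Kt (k i) (maxDomT ν.M₁ (Z i))) (Bj ν.M₁ (Z i) (k i))
              (avgFamily (Node00.avOfRecord F 2 Kt) (qsstarGIter0 (k i) (expMul su2Chart B' (ext i (expMul su2Chart p Vk))))) U')
    -- (N) THE NEAR-FLAT LETTER PACKAGE per instance, asked ONLY at the guarded base fields whose extended datum is `ρn i`-near `1` on `𝒞 i` (replaces (L2))
    {δc μc ρc δ₂c Kc τc : ι → ℝ} (hδc0 : ∀ i, 0 ≤ δc i) (hμc0 : ∀ i, 0 ≤ μc i) (hρc0 : ∀ i, 0 ≤ ρc i) (hδ₂c0 : ∀ i, 0 ≤ δ₂c i)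
    (hNFn : ∀ i (Vk : GaugeField (F.P Kt) (k i) SU2), PlaqSmallOn (plaqsInside (pts (k i) (Z i ∩ (Λ i)ᶜ))) (eR i) Vk →
      (∀ b ∈ 𝒞 i, dist1 (ext i Vk b) ≤ ρn i) →
      ∃ (U₀ : GaugeField (F.P Kt) 0 SU2) (Xf : GaugeSlice (pts (k i) (Λ i)) (T i) E3 → PBond (F.P Kt) 0 → lieSU (Fin 2)),
        (∀ p : Plaq (F.P Kt) 0, ((⟨p.src, p.μ⟩ : PBond (F.P Kt) 0) ∈ {b : PBond (F.P Kt) 0 | b.src ∈ maxDomT ν.M₁ (Z i) 1} ∨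
            (⟨p.src.shift p.μ, p.ν⟩ : PBond (F.P Kt) 0) ∈ {b : PBond (F.P Kt) 0 | b.src ∈ maxDomT ν.M₁ (Z i) 1} ∨
            (⟨p.src.shift p.ν, p.μ⟩ : PBond (F.P Kt) 0) ∈ {b : PBond (F.P Kt) 0 | b.src ∈ maxDomT ν.M₁ (Z i) 1} ∨
            (⟨p.src, p.ν⟩ : PBond (F.P Kt) 0) ∈ {b : PBond (F.P Kt) 0 | b.src ∈ maxDomT ν.M₁ (Z i) 1}) →
          ‖((U₀ ⟨p.src, p.μ⟩ : SU2) : Matrix (Fin 2) (Fin 2) ℂ) - 1‖ ≤ δc i ∧ ‖((U₀ ⟨p.src.shift p.μ, p.ν⟩ : SU2) : Matrix (Fin 2) (Fin 2) ℂ) - 1‖ ≤ δc i ∧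
            ‖((U₀ ⟨p.src.shift p.ν, p.μ⟩ : SU2) : Matrix (Fin 2) (Fin 2) ℂ) - 1‖ ≤ δc i ∧ ‖((U₀ ⟨p.src, p.ν⟩ : SU2) : Matrix (Fin 2) (Fin 2) ℂ) - 1‖ ≤ δc i) ∧
        Xf 0 = 0 ∧ ContDiffAt ℝ 2 Xf 0 ∧
        (∀ᶠ Y in 𝓝 (0 : GaugeSlice (pts (k i) (Λ i)) (T i) E3),
          IsMinimizer (Node00.avOfRecord F 2 Kt) (Node00.regMSCoPOfRecord F 2 ν Kt (k i) (maxDomT ν.M₁ (Z i))) (Bj ν.M₁ (Z i) (k i))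
            (avgFamily (Node00.avOfRecord F 2 Kt) (qsstarGIter0 (k i) (expMul su2Chart (ιA (pts (k i) (Λ i)) (T i) Y) (ext i Vk)))) (expChart U₀ (Xf Y))) ∧
        ∃ (Ψ₂ : (PBond (F.P Kt) 0 → lieSU (Fin 2)) →L[ℝ] (PBond (F.P Kt) 0 → lieSU (Fin 2)) →L[ℝ] (Fin (constrCard (Bj ν.M₁ (Z i) (k i)) (k i)) → lieSU (Fin 2)))
          (lam : (Fin (constrCard (Bj ν.M₁ (Z i) (k i)) (k i)) → lieSU (Fin 2)) →L[ℝ] ℝ)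
          (p : Seminorm ℝ (PBond (F.P Kt) 0 → lieSU (Fin 2))) (q : (Fin (constrCard (Bj ν.M₁ (Z i) (k i)) (k i)) → lieSU (Fin 2)) → ℝ)
          (Lf : (PBond (F.P Kt) 0 → lieSU (Fin 2)) →L[ℝ] (Fin (constrCard (Bj ν.M₁ (Z i) (k i)) (k i)) → lieSU (Fin 2)))
          (Rf : (Fin (constrCard (Bj ν.M₁ (Z i) (k i)) (k i)) → lieSU (Fin 2)) → PBond (F.P Kt) 0 → lieSU (Fin 2)),
          HasFDerivAt (fun Y => fderiv ℝ (msChart F 2 Kt (k i) (Bj ν.M₁ (Z i) (k i)) (avgFamily (Node00.avOfRecord F 2 Kt) (qsstarGIter0 (k i) (ext i Vk))) U₀) Y) Ψ₂ 0 ∧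
          (∀ᶠ Y in 𝓝 (0 : PBond (F.P Kt) 0 → lieSU (Fin 2)),
            DifferentiableAt ℝ (msChart F 2 Kt (k i) (Bj ν.M₁ (Z i) (k i)) (avgFamily (Node00.avOfRecord F 2 Kt) (qsstarGIter0 (k i) (ext i Vk))) U₀) Y) ∧
          fderiv ℝ (fun Y : PBond (F.P Kt) 0 → lieSU (Fin 2) => wilsonAction4 (expChart U₀ Y)) 0 =
            lam.comp (fderiv ℝ (msChart F 2 Kt (k i) (Bj ν.M₁ (Z i) (k i)) (avgFamily (Node00.avOfRecord F 2 Kt) (qsstarGIter0 (k i) (ext i Vk))) U₀) 0) ∧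
          (∀ Y : PBond (F.P Kt) 0 → lieSU (Fin 2), ∑ b, ‖(Y b : Matrix (Fin 2) (Fin 2) ℂ)‖ ^ 2 ≤ p Y ^ 2) ∧
          (∀ v, Lf (Rf v) = v) ∧ (∀ v, p (Rf v) ≤ ρc i * q v) ∧
          ∀ X : GaugeSlice (pts (k i) (Λ i)) (T i) E3,
            q (fderiv ℝ (msChart F 2 Kt (k i) (Bj ν.M₁ (Z i) (k i)) (avgFamily (Node00.avOfRecord F 2 Kt) (qsstarGIter0 (k i) (ext i Vk))) U₀) 0 (fderiv ℝ Xf 0 X)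
                - Lf (fderiv ℝ Xf 0 X)) ≤ δ₂c i * p (fderiv ℝ Xf 0 X) ∧
            lam (Ψ₂ (fderiv ℝ Xf 0 X) (fderiv ℝ Xf 0 X)) ≤ μc i * p (fderiv ℝ Xf 0 X) ^ 2 ∧
            p (fderiv ℝ Xf 0 X) ≤ Kc i * ‖X‖ ∧
            ∃ m : ℝ, (∀ w', Lf w' = fderiv ℝ (msChart F 2 Kt (k i) (Bj ν.M₁ (Z i) (k i)) (avgFamily (Node00.avOfRecord F 2 Kt) (qsstarGIter0 (k i) (ext i Vk))) U₀) 0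
                  (fderiv ℝ Xf 0 X) →
                m ≤ fderiv ℝ (fun Y => fderiv ℝ (fun Y : PBond (F.P Kt) 0 → lieSU (Fin 2) => wilsonAction4 (expChart (1 : GaugeField (F.P Kt) 0 SU2) Y)) Y) 0 w' w') ∧
              γ₀ * (∑ z ∈ box (fun κ => (hi i κ - lo i κ + 1).toNat + 3) (fun κ => lo i κ - 2), ∑ μ : Fin (F.P Kt).d, ∑ a : Fin 3,
                  curl (fun b => ιA (pts (k i) (Λ i)) (T i) X (⟨castSite b.1, b.2⟩ : PBond (F.P Kt) (k i)) a) z ⟨0, h0⟩ μ ^ 2) - τc i * ‖X‖ ^ 2 ≤ m)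
    -- numerics: the assembled `Cerr i` (with the twist defect `τc i`) is small, and the positivity constant fits
    (hsm : ∀ i, (32 * (((F.P Kt).d : ℝ) - 1) * δc i + μc i + 16 * (((F.P Kt).d : ℝ) - 1) * (ρc i * δ₂c i) * (2 + ρc i * δ₂c i)) * Kc i ^ 2 + τc i
      ≤ γ₀ / (2 * (3 * (K i : ℝ) ^ 2 + 2 * (K i : ℝ) ^ 4)))
    (hγle : ∀ i, γ / (M i) ^ 5 ≤ γ₀ / (2 * (3 * (K i : ℝ) ^ 2 + 2 * (K i : ℝ) ^ 4)))
    (hfar : ∀ i (b : PBond (F.P Kt) 0), b.src ∉ maxDomT ν.M₁ (Z i) 1 →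
      (⟨blockIter (k i) b.src, b.dir⟩ : PBond (F.P Kt) (k i)) ∉ bondsOf (pts (k i) (Λ i)))
    (hZblk : ∀ i, IsBlockUnion (k i) (Z i))
    (hM2 : 2 ≤ ν.M₁) (hdiv : ∀ i, side (F.P Kt).L ν.M₁ (k i) ∣ (F.P Kt).sitesPerDir 0)
    {cE B₃ a₀ a₁' cA : ℝ} (hcE0 : 0 ≤ cE) (hcE : ∀ i, 12 * ((F.P Kt).d : ℝ) * ((n i : ℝ) + 2) ^ 2 ≤ cE) (hB₃ : 0 ≤ B₃)
    (heRa : ∀ i, (cE + 1) * eR i ≤ a₁' ∧ B₃ * ((cE + 1) * eR i) ≤ ν.εreg) (ha₀ : ν.εreg ≤ a₀)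
    (hcA : 1 / 2 * (B₃ * (cE + 1) * (F.P Kt).eta 1 ^ 2) ^ 2 * (Fintype.card (Plaq (F.P Kt) 0) : ℝ) ≤ cA)
    (h15T : ∀ (k' : ℕ), k' ≤ (F.P Kt).m + (F.P Kt).K → side (F.P Kt).L ν.M₁ k' ∣ (F.P Kt).sitesPerDir 0 →
      ∀ (s : B14.Eq218Concrete.Seq (fun n : ℕ => Node00.unionsOfCubes (F.P Kt) (side (F.P Kt).L ν.M₁ n)) k'),
      Node00.Sect2.SeqSeparated ν.M₁ s → 0 < ν.M₁ →
      ∀ (ε₀ : ℝ) (δ : ℕ → ℝ), (∀ j, j ≤ k' → 0 < δ j ∧ δ j ≤ a₁' ∧ B₃ * δ j ≤ ε₀) → (∀ j, j < k' → δ j ≤ 2 * δ (j + 1)) →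
      (∀ j, j < k' → δ (j + 1) ≤ 2 * δ j) → ε₀ ≤ a₀ →
      ∀ W : MSField (F.P Kt) SU2,
        Node00.Sect2.DataSmall7PTop (Node00.avOfRecord F 2 Kt) s.Ω (Node00.suppDomOfRecord F ν Kt s.Ω) k' δ W →
        ∀ U₀ : GaugeField (F.P Kt) 0 SU2, IsMinimizer (Node00.avOfRecord F 2 Kt)
            {U | (∀ j, j ≤ k' → PlaqSmallOn (Node00.Sect2.omegaPlaqsTop s.Ω (Node00.suppDomOfRecord F ν Kt s.Ω) j)
                (ε₀ * (F.P Kt).eta j ^ 2) U) ∧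
              Node00.Sect2.CoDivClassOnTop s.Ω (Node00.suppDomOfRecord F ν Kt s.Ω) k' ε₀ U}
            (genSet s.Ω k') W U₀ →
          (∀ j, j ≤ k' → PlaqSmallOn (Node00.Sect2.omegaPlaqsTop s.Ω (Node00.suppDomOfRecord F ν Kt s.Ω) j)
              (B₃ * δ j * (F.P Kt).eta j ^ 2) U₀) ∧
            ∀ j, j ≤ k' → Node00.Sect2.CoDivSmallOn (Node00.Sect2.omegaBondsTop s.Ω (Node00.suppDomOfRecord F ν Kt s.Ω) j)
              (B₃ * δ j * (F.P Kt).eta j ^ 3) U₀)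
    : ∃ R : ι → ℝ, (∀ i, 0 < R i) ∧ ∃ a₁ : ι → ℝ, (∀ i, 0 < a₁ i) ∧
      B15.Prop1Printed (lfVarOn su2Chart fun i =>
        InstOn.std (Node00.bgMSCoPOfRecord F 2 ν Kt (k i) (maxDomT ν.M₁ (Z i))) ν.M₁ (Z i) (Λ i) (k i) (M i) (a₁ i)
          (anExt (pts (k i) (Λ i)) (T i)
            (fun177std (Node00.bgMSCoPOfRecord F 2 ν Kt (k i) (maxDomT ν.M₁ (Z i))) ν.M₁ (Z i) (k i)) (ext i)
            (min (1 / 2) (min (R i / 8) (γ / (M i) ^ 5 * (R i / 2) ^ 2 /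
              (48 * (4 * ((Fintype.card (Plaq (F.P Kt) 0) : ℝ) * (1 + 8 * 𝓐₀ i ^ 4)) / R i + 1))))))) :=
  B15Prop1CoerciveEdition.exists_domain_prop1Printed_lfVarOn_std_su2_box_intrinsic_analytic_atZSeqCoPRecord_ofThm1TorusClass_ofMinimiserFamilyCompact_ofCoercive
    ν Kt hd3 h0 (hdec := inferInstance) (Subsingleton.elim _ _)
    Z Λ k M hk0 hk eR heR T lo hi n hn hN hbox hZ hTG0 hN5 ext hext hlohi hγ hbx hbxM hM hMinC
    (hcoer_of_nearFlatLettersGaugeNormalisable_sub_loc ν Kt hd3 h0 Z Λ k M hk0 hk eR T lo hi hbox hTG0 hN5 K hK1 hKn ext hext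
      𝒞 ρn hgauge hγ₀ hδc0 hμc0 hρc0 hδ₂c0 hNFn hsm hγle hfar)
    hfar hZblk hM2 hdiv hcE0 hcE hB₃ heRa ha₀ hcA h15T

end GeneralRegion

end Literature.MathematicalPhysics.QuantumFieldTheory.Balaban1983to89.B15Prop1CoerciveAtNormalisedDatum

end
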